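import Literature.Analysis.OperatorTheory.FreeDeterminantalRealization
import Literature.Analysis.OperatorTheory.FormalEulerLogarithm
import Mathlib.Data.Finsupp.Multiset
import Mathlib.RingTheory.MvPowerSeries.Trunc
import Mathlib.Analysis.SpecificLimits.Normed
import Mathlib.Analysis.Normed.Ring.Units
import Mathlib.RingTheory.PowerSeries.Exp
import Mathlib.Analysis.Complex.Exponential
import Mathlib.Analysis.Complex.CauchyIntegral
import Mathlib.Analysis.Calculus.FDeriv.Mul
import Mathlib.MeasureTheory.Integral.CircleIntegral

/-!
# Noncommutative lifts of a commutative polynomial and their invertibility on a larger nc polydisc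

## Part 1 — Noncommutative lifts of a commutative polynomial with constant term `1`

Weighted coefficient norms `|F|_ρ = Σ_w ‖F_w‖ ρ^{|w|}` on `ℂ⟨g_σ⟩` (`wnorm`: subadditive,
submultiplicative, `‖F(X)‖ ≤ |F|_ρ` when `‖X_j‖ ≤ ρ` — `norm_ncEval_le`), word filters
(`wfilter`, truncation `truncW`, homogeneous parts `hpart`, the tail estimate
`wnorm_sub_truncW_le`, homogeneity `ncEval_smul_hpart`), the canonical lift `ncLift` of a finitely
supported family of commutative coefficients (`wordOf α`, `coeff_ab_ncLift`), and **the nc lift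
`pLift N P = trunc_N exp(Ĥ_N)`** of a polynomial `P` with `P(0) = 1`, where `Ĥ_N` lifts the
truncated Euler logarithm of `P` (`FormalEulerLogarithm.lean`): `ab (pLift N P) = P` for
`N ≥ deg P` (**`ab_pLift`**), `(pLift N P)_∅ = 1` (`coeff_one_pLift`), and the coefficient bound
`sum_norm_coeff_eulerLog_le` (`Σ_{α∈S} ‖h_α‖ ρ^{|α|} ≤ (Σ_β ‖P_β‖ ρ^{|β|}) · sup_T Σ_{γ∈T} ‖(P⁻¹)_γ‖ ρ^{|γ|}`).
This replaces, in the proof of [GrinshpanEtAl2015, Thm. 3.1], the lift obtained there from a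
(non-contractive) determinantal representation `P = det(I - K Z_n)`; the exponential lift is
invertible on a LARGER nc polydisc (the second part of this file), which the argument needs.
All statements are folklore; grouping namespace `GKVVW`.

## Part 2 — Invertibility of the nc lift on a larger nc polydisc and the `Q P̂ + E = 1` certificates

In a complete normed algebra: the Neumann lemma (`isUnit_one_sub_of_norm_le`), units from
two-sided approximate inverses and perturbation (`isUnit_of_mul_eq_one_add`,
`isUnit_of_norm_sub_le`), truncated exponentials `texp N x = Σ_{k≤N} x^k/k!` with
`‖texp N x · texp N (-x) - 1‖ ≤ e^{4B}/2^{N+1}` (`norm_texp_mul_texp_neg_sub_one_le`, via the Cauchy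
product of `e^X e^{-X} = 1`, Mathlib `PowerSeries.exp_mul_exp_neg_eq_one`) and `isUnit_texp`.
For an nc polynomial `P̂` with constant term `1`: the truncated inverse series
`Q_K = trunc_K Σ_{j≤K} (1 - P̂)^j` (`qapprox`) and the remainder `R_K = Q_K P̂ - 1` (`rrem`), whose
words have length in `(K, K + D]` (`succ_le_length_of_mem_support_rrem`); **the circle estimate**
`norm_ncEval_hpart_qapprox_le`: if `P̂(Y)` is invertible with `‖P̂(Y)⁻¹‖ ≤ M₂` whenever
`‖Y_j‖ ≤ ρ'`, then `‖(Q_K)_k(X)‖ ≤ M₂ ρ'^{-k}` for contractions `X` (`(Q_K)_k(X)` is the `k`-th Taylor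
coefficient of `t ↦ P̂(tX)⁻¹`: Cauchy's formula on `|t| = ρ'`, Mathlib `circleIntegral`); hence
`‖Q_K(X)‖ ≤ M₂/(1 - 1/ρ')`, `‖R_K(X)‖ → 0` (`norm_ncEval_rrem_le`) and **`exists_QE_of_inv`**: the
hypothesis of the free Positivstellensatz `hsqN_sub_smul_unitK_mem_coneN`. All statements are
folklore (one-variable Cauchy estimates); grouping namespace `GKVVW`.

## References

* [GrinshpanEtAl2015] A. Grinshpan, D. S. Kaliuzhnyi-Verbovetskyi, V. Vinnikov, H. J. Woerdeman,
  Contractive determinantal representations of stable polynomials on a matrix polyball, Math. Z. 283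
  (2016) 25–37, proof of Thm. 3.1 (the lift of `p`; the quantities `‖g_ρ‖_𝒜`, `c`).
-/

noncomputable section

namespace Literature.Analysis.OperatorTheory
namespace GKVVW

section Norms
open Finset

variable {σ : Type}

/-! ### Weighted coefficient norms `|F|_ρ = Σ_w |F_w| ρ^{|w|}` -/

/-- The weighted `ℓ¹` coefficient norm `|F|_ρ = Σ_w ‖F_w‖ ρ^{|w|}` of an nc polynomial. [folklore] -/
def wnorm (ρ : ℝ) (F : NC σ) : ℝ := ∑ u ∈ F.coeff.support, ‖F.coeff u‖ * ρ ^ u.length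

/-- The weighted norm may be summed over any finite set of words containing the support. [folklore] -/
theorem wnorm_eq_sum {ρ : ℝ} (F : NC σ) {U : Finset (FreeMonoid σ)} (hU : F.coeff.support ⊆ U) :
    wnorm ρ F = ∑ u ∈ U, ‖F.coeff u‖ * ρ ^ u.length :=
  Finset.sum_subset hU fun u _ hu => by
    rw [Finsupp.notMem_support_iff.mp hu, norm_zero, zero_mul]

/-- `0 ≤ |F|_ρ` for `ρ ≥ 0`. [folklore] -/
theorem wnorm_nonneg {ρ : ℝ} (hρ : 0 ≤ ρ) (F : NC σ) : 0 ≤ wnorm ρ F :=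
  Finset.sum_nonneg fun _ _ => mul_nonneg (norm_nonneg _) (pow_nonneg hρ _)

/-- `|0|_ρ = 0`. [folklore] -/
theorem wnorm_zero (ρ : ℝ) : wnorm ρ (0 : NC σ) = 0 := by
  rw [wnorm, MonoidAlgebra.coeff_zero, Finsupp.support_zero, Finset.sum_empty]

/-- Subadditivity: `|F + G|_ρ ≤ |F|_ρ + |G|_ρ` (`ρ ≥ 0`). [folklore] -/
theorem wnorm_add_le {ρ : ℝ} (hρ : 0 ≤ ρ) (F G : NC σ) :
    wnorm ρ (F + G) ≤ wnorm ρ F + wnorm ρ G := by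
  classical
  have hFG : (F + G).coeff.support ⊆ F.coeff.support ∪ G.coeff.support := by
    rw [MonoidAlgebra.coeff_add]; exact Finsupp.support_add
  rw [wnorm_eq_sum _ hFG, wnorm_eq_sum F subset_union_left, wnorm_eq_sum G subset_union_right,
    ← Finset.sum_add_distrib]
  refine Finset.sum_le_sum fun u _ => ?_
  rw [MonoidAlgebra.coeff_add, Finsupp.add_apply, ← add_mul]
  exact mul_le_mul_of_nonneg_right (norm_add_le _ _) (pow_nonneg hρ _)

/-- `|Σ_i F_i|_ρ ≤ Σ_i |F_i|_ρ` (`ρ ≥ 0`). [folklore] -/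
theorem wnorm_sum_le {ρ : ℝ} (hρ : 0 ≤ ρ) {ι : Type*} (s : Finset ι) (f : ι → NC σ) :
    wnorm ρ (∑ i ∈ s, f i) ≤ ∑ i ∈ s, wnorm ρ (f i) :=
  Finset.le_sum_of_subadditive (wnorm ρ) (wnorm_zero ρ).le (wnorm_add_le hρ) s f

/-- Homogeneity: `|a • F|_ρ = ‖a‖ |F|_ρ`. [folklore] -/
theorem wnorm_smul {ρ : ℝ} (a : ℂ) (F : NC σ) : wnorm ρ (a • F) = ‖a‖ * wnorm ρ F := by
  have hs : (a • F).coeff.support ⊆ F.coeff.support := by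
    rw [MonoidAlgebra.coeff_smul]; exact Finsupp.support_smul
  rw [wnorm_eq_sum _ hs, wnorm, Finset.mul_sum]
  refine Finset.sum_congr rfl fun u _ => ?_
  rw [MonoidAlgebra.coeff_smul, Finsupp.smul_apply, smul_eq_mul, norm_mul, mul_assoc]

/-- `|a·w|_ρ ≤ ‖a‖ ρ^{|w|}` for a monomial. [folklore] -/
theorem wnorm_single_le (ρ : ℝ) (u : FreeMonoid σ) (a : ℂ) :
    wnorm ρ (MonoidAlgebra.single u a) ≤ ‖a‖ * ρ ^ u.length := by
  have hs : (MonoidAlgebra.single u a).coeff.support ⊆ {u} := by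
    rw [MonoidAlgebra.coeff_single]; exact Finsupp.support_single_subset
  rw [wnorm_eq_sum _ hs, Finset.sum_singleton, MonoidAlgebra.coeff_single, Finsupp.single_eq_same]

/-- `|1|_ρ ≤ 1`. [folklore] -/
theorem wnorm_one_le (ρ : ℝ) : wnorm ρ (1 : NC σ) ≤ 1 := by
  rw [MonoidAlgebra.one_def]
  refine (wnorm_single_le ρ _ _).trans ?_
  rw [norm_one, FreeMonoid.length_one, pow_zero, mul_one]

/-- `|·|_ρ` is submultiplicative. [folklore] -/
theorem wnorm_mul_le {ρ : ℝ} (hρ : 0 ≤ ρ) (F G : NC σ) :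
    wnorm ρ (F * G) ≤ wnorm ρ F * wnorm ρ G := by
  rw [MonoidAlgebra.mul_def, Finsupp.sum]
  refine (wnorm_sum_le hρ _ _).trans ?_
  rw [wnorm, wnorm, Finset.sum_mul_sum]
  refine Finset.sum_le_sum fun u _ => ?_
  rw [Finsupp.sum]
  refine (wnorm_sum_le hρ _ _).trans (Finset.sum_le_sum fun v _ => ?_)
  refine (wnorm_single_le ρ _ _).trans (le_of_eq ?_)
  rw [norm_mul, FreeMonoid.length_mul, pow_add]; ring

/-- `|F^k|_ρ ≤ |F|_ρ^k` (submultiplicativity, `ρ ≥ 0`). [folklore] -/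
theorem wnorm_pow_le {ρ : ℝ} (hρ : 0 ≤ ρ) (F : NC σ) (k : ℕ) :
    wnorm ρ (F ^ k) ≤ wnorm ρ F ^ k := by
  induction k with
  | zero => rw [pow_zero, pow_zero]; exact wnorm_one_le ρ
  | succ k ih =>
    rw [pow_succ, pow_succ]
    exact (wnorm_mul_le hρ _ _).trans
      (mul_le_mul_of_nonneg_right ih (wnorm_nonneg hρ _))

/-- `|F|_ρ` is monotone in `ρ ≥ 0`. [folklore] -/
theorem wnorm_mono {ρ ρ' : ℝ} (hρ : 0 ≤ ρ) (h : ρ ≤ ρ') (F : NC σ) : wnorm ρ F ≤ wnorm ρ' F :=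
  Finset.sum_le_sum fun _ _ =>
    mul_le_mul_of_nonneg_left (pow_le_pow_left₀ hρ h _) (norm_nonneg _)

/-! ### Evaluation bounds -/

section Eval

variable {𝔄 : Type*} [NormedRing 𝔄]

/-- `‖X^w‖ ≤ ρ^{|w|}` when `‖X_j‖ ≤ ρ` (and `‖1‖ ≤ 1`). [folklore] -/
theorem norm_lift_le (X : σ → 𝔄) {ρ : ℝ} (hρ : 0 ≤ ρ) (hX : ∀ j, ‖X j‖ ≤ ρ)
    (h1 : ‖(1 : 𝔄)‖ ≤ 1) (w : FreeMonoid σ) : ‖FreeMonoid.lift X w‖ ≤ ρ ^ w.length := by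
  induction w using FreeMonoid.inductionOn' with
  | one => rw [map_one, FreeMonoid.length_one, pow_zero]; exact h1
  | mul_of j w ih =>
    rw [map_mul, FreeMonoid.lift_eval_of, FreeMonoid.length_mul, FreeMonoid.length_of, pow_add,
      pow_one]
    exact (norm_mul_le _ _).trans (mul_le_mul (hX j) ih (norm_nonneg _) hρ)

variable [NormedAlgebra ℂ 𝔄]

/-- `F(X) = Σ_w F_w X^w`, the sum over the support of `F`. [folklore] -/
theorem ncEval_eq_sum (X : σ → 𝔄) (F : NC σ) :
    ncEval X F = ∑ u ∈ F.coeff.support, F.coeff u • FreeMonoid.lift X u := by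
  rw [ncEval, MonoidAlgebra.lift_apply, Finsupp.sum]

/-- **`‖F(X)‖ ≤ |F|_ρ`** when `‖X_j‖ ≤ ρ`. [folklore] -/
theorem norm_ncEval_le (X : σ → 𝔄) {ρ : ℝ} (hρ : 0 ≤ ρ) (hX : ∀ j, ‖X j‖ ≤ ρ)
    (h1 : ‖(1 : 𝔄)‖ ≤ 1) (F : NC σ) : ‖ncEval X F‖ ≤ wnorm ρ F := by
  rw [ncEval_eq_sum]
  refine (norm_sum_le _ _).trans (Finset.sum_le_sum fun u _ => ?_)
  exact (norm_smul_le _ _).trans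
    (mul_le_mul_of_nonneg_left (norm_lift_le X hρ hX h1 u) (norm_nonneg _))

/-- Scaling a tuple scales a word by `t^{|w|}`. [folklore] -/
theorem lift_smul (X : σ → 𝔄) (t : ℂ) (w : FreeMonoid σ) :
    FreeMonoid.lift (fun j => t • X j) w = t ^ w.length • FreeMonoid.lift X w := by
  induction w using FreeMonoid.inductionOn' with
  | one => rw [map_one, map_one, FreeMonoid.length_one, pow_zero, one_smul]
  | mul_of j w ih =>
    rw [map_mul, FreeMonoid.lift_eval_of, map_mul, FreeMonoid.lift_eval_of, ih,
      FreeMonoid.length_mul, FreeMonoid.length_of, pow_add, pow_one, smul_mul_smul_comm]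

end Eval

/-! ### Word filters: truncations and homogeneous parts -/

/-- Keep only the words satisfying `p`. [folklore] -/
def wfilter (p : FreeMonoid σ → Prop) [DecidablePred p] : NC σ →ₗ[ℂ] NC σ where
  toFun F := MonoidAlgebra.ofCoeff (F.coeff.filter p)
  map_add' F G := by
    apply MonoidAlgebra.coeff_injective
    simp only [MonoidAlgebra.coeff_add, Finsupp.filter_add]
  map_smul' a F := by
    apply MonoidAlgebra.coeff_injective
    simp only [MonoidAlgebra.coeff_smul, Finsupp.filter_smul, RingHom.id_apply]

/-- Coefficients of the word filter: `(wfilter p F)_w = F_w` if `p w`, else `0`. [folklore] -/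
theorem coeff_wfilter (p : FreeMonoid σ → Prop) [DecidablePred p] (F : NC σ) (w : FreeMonoid σ) :
    (wfilter p F).coeff w = if p w then F.coeff w else 0 := by
  rw [wfilter, LinearMap.coe_mk, AddHom.coe_mk, MonoidAlgebra.coeff_ofCoeff, Finsupp.filter_apply]

/-- The support of `wfilter p F` is the support of `F` filtered by `p`. [folklore] -/
theorem support_wfilter (p : FreeMonoid σ → Prop) [DecidablePred p] (F : NC σ) :
    (wfilter p F).coeff.support = F.coeff.support.filter p := by
  rw [wfilter, LinearMap.coe_mk, AddHom.coe_mk, MonoidAlgebra.coeff_ofCoeff, Finsupp.support_filter]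

/-- `wfilter p F = Σ_{w ∈ supp F, p w} F_w · w`. [folklore] -/
theorem wfilter_eq_sum (p : FreeMonoid σ → Prop) [DecidablePred p] (F : NC σ) :
    wfilter p F = ∑ u ∈ F.coeff.support with p u, MonoidAlgebra.single u (F.coeff u) := by
  classical
  apply MonoidAlgebra.coeff_injective
  ext w
  rw [coeff_wfilter, MonoidAlgebra.coeff_sum, Finsupp.finsetSum_apply]
  simp only [MonoidAlgebra.coeff_single, Finsupp.single_apply]
  rw [Finset.sum_ite_eq']
  simp only [Finset.mem_filter, Finsupp.mem_support_iff]
  by_cases hp : p w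
  · by_cases hw : F.coeff w = 0
    · simp [hp, hw]
    · simp [hp, hw]
  · simp [hp]

/-- A word filter does not increase the weighted norm (`ρ ≥ 0`). [folklore] -/
theorem wnorm_wfilter_le {ρ : ℝ} (hρ : 0 ≤ ρ) (p : FreeMonoid σ → Prop) [DecidablePred p]
    (F : NC σ) : wnorm ρ (wfilter p F) ≤ wnorm ρ F := by
  have hs : (wfilter p F).coeff.support ⊆ F.coeff.support := by
    rw [support_wfilter]; exact Finset.filter_subset _ _
  rw [wnorm_eq_sum _ hs, wnorm]
  refine Finset.sum_le_sum fun u _ => mul_le_mul_of_nonneg_right ?_ (pow_nonneg hρ _)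
  rw [coeff_wfilter]
  split_ifs
  · exact le_rfl
  · rw [norm_zero]; exact norm_nonneg _

/-- `wfilter p F + wfilter (¬p) F = F`. [folklore] -/
theorem wfilter_add_wfilter_not (p : FreeMonoid σ → Prop) [DecidablePred p] (F : NC σ) :
    wfilter p F + wfilter (fun u => ¬ p u) F = F := by
  apply MonoidAlgebra.coeff_injective
  ext w
  rw [MonoidAlgebra.coeff_add, Finsupp.add_apply, coeff_wfilter, coeff_wfilter]
  split_ifs <;> simp

/-- `wfilter p F = F` when every word of the support satisfies `p`. [folklore] -/
theorem wfilter_true_of_forall (p : FreeMonoid σ → Prop) [DecidablePred p] (F : NC σ)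
    (h : ∀ u ∈ F.coeff.support, p u) : wfilter p F = F := by
  apply MonoidAlgebra.coeff_injective
  ext w
  rw [coeff_wfilter]
  split_ifs with hw
  · rfl
  · by_contra hne
    exact hw (h w (Finsupp.mem_support_iff.mpr (Ne.symm hne)))

/-- Truncation to words of length `≤ N`. [folklore] -/
def truncW (N : ℕ) : NC σ →ₗ[ℂ] NC σ := wfilter fun u => u.length ≤ N

/-- The homogeneous part of word-length `k`. [folklore] -/
def hpart (k : ℕ) : NC σ →ₗ[ℂ] NC σ := wfilter fun u => u.length = k

/-- Coefficients of the truncation: `(trunc_N F)_w = F_w` if `|w| ≤ N`, else `0`. [folklore] -/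
theorem coeff_truncW (N : ℕ) (F : NC σ) (w : FreeMonoid σ) :
    (truncW N F).coeff w = if w.length ≤ N then F.coeff w else 0 := coeff_wfilter _ F w

/-- Coefficients of the homogeneous part: `(F_k)_w = F_w` if `|w| = k`, else `0`. [folklore] -/
theorem coeff_hpart (k : ℕ) (F : NC σ) (w : FreeMonoid σ) :
    (hpart k F).coeff w = if w.length = k then F.coeff w else 0 := coeff_wfilter _ F w

/-- Words in the support of the `k`-th homogeneous part have length `k`. [folklore] -/
theorem mem_support_hpart {k : ℕ} {F : NC σ} {w : FreeMonoid σ} (h : w ∈ (hpart k F).coeff.support) :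
    w.length = k := by
  rw [hpart, support_wfilter, Finset.mem_filter] at h
  exact h.2

/-- **Tail estimate**: `|F - trunc_N F|_ρ ≤ (ρ/ρ')^{N+1} |F|_{ρ'}` for `0 ≤ ρ ≤ ρ'`. [folklore] -/
theorem wnorm_sub_truncW_le {ρ ρ' : ℝ} (hρ : 0 ≤ ρ) (hρρ' : ρ ≤ ρ') (hρ' : 0 < ρ') (N : ℕ)
    (F : NC σ) : wnorm ρ (F - truncW N F) ≤ (ρ / ρ') ^ (N + 1) * wnorm ρ' F := by
  have hF : F - truncW N F = wfilter (fun u => ¬ u.length ≤ N) F := by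
    rw [sub_eq_iff_eq_add, add_comm]; exact (wfilter_add_wfilter_not _ F).symm
  rw [hF]
  have hs : (wfilter (fun u => ¬ u.length ≤ N) F).coeff.support ⊆ F.coeff.support := by
    rw [support_wfilter]; exact Finset.filter_subset _ _
  rw [wnorm_eq_sum _ hs, wnorm, Finset.mul_sum]
  refine Finset.sum_le_sum fun u _ => ?_
  rw [coeff_wfilter]
  split_ifs with hu
  · rw [norm_zero, zero_mul]
    exact mul_nonneg (pow_nonneg (div_nonneg hρ hρ'.le) _)
      (mul_nonneg (norm_nonneg _) (pow_nonneg hρ'.le _))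
  · have hq1 : ρ / ρ' ≤ 1 := (div_le_one hρ').mpr hρρ'
    have hq0 : 0 ≤ ρ / ρ' := div_nonneg hρ hρ'.le
    have hlen : N + 1 ≤ u.length := Nat.lt_of_not_le hu
    have hpow : ρ ^ u.length = (ρ / ρ') ^ u.length * ρ' ^ u.length := by
      rw [div_pow, div_mul_cancel₀ _ (pow_ne_zero _ hρ'.ne')]
    calc ‖F.coeff u‖ * ρ ^ u.length
        = (ρ / ρ') ^ u.length * (‖F.coeff u‖ * ρ' ^ u.length) := by rw [hpow]; ring
      _ ≤ (ρ / ρ') ^ (N + 1) * (‖F.coeff u‖ * ρ' ^ u.length) :=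
          mul_le_mul_of_nonneg_right (pow_le_pow_of_le_one hq0 hq1 hlen)
            (mul_nonneg (norm_nonneg _) (pow_nonneg hρ'.le _))

/-- A polynomial with words of length `≤ D` is the sum of its homogeneous parts. [folklore] -/
theorem sum_hpart_eq {D : ℕ} (F : NC σ) (hD : ∀ u ∈ F.coeff.support, u.length ≤ D) :
    ∑ k ∈ range (D + 1), hpart k F = F := by
  apply MonoidAlgebra.coeff_injective
  ext w
  rw [MonoidAlgebra.coeff_sum, Finsupp.finsetSum_apply]
  simp only [coeff_hpart]
  rw [Finset.sum_ite_eq]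
  by_cases hw : w ∈ F.coeff.support
  · simp [Finset.mem_range, Nat.lt_succ_of_le (hD w hw)]
  · rw [Finsupp.notMem_support_iff.mp hw]; simp

section Eval

variable {𝔄 : Type*} [NormedRing 𝔄] [NormedAlgebra ℂ 𝔄]

/-- Homogeneity: `F_k(tX) = t^k F_k(X)`. [folklore] -/
theorem ncEval_smul_hpart (X : σ → 𝔄) (t : ℂ) (k : ℕ) (F : NC σ) :
    ncEval (fun j => t • X j) (hpart k F) = t ^ k • ncEval X (hpart k F) := by
  rw [ncEval_eq_sum, ncEval_eq_sum, Finset.smul_sum]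
  refine Finset.sum_congr rfl fun u hu => ?_
  rw [lift_smul, mem_support_hpart hu, smul_comm]

/-- `F(tX) = Σ_k t^k F_k(X)`. [folklore] -/
theorem ncEval_smul_eq_sum (X : σ → 𝔄) (t : ℂ) {D : ℕ} (F : NC σ)
    (hD : ∀ u ∈ F.coeff.support, u.length ≤ D) :
    ncEval (fun j => t • X j) F = ∑ k ∈ range (D + 1), t ^ k • ncEval X (hpart k F) := by
  conv_lhs => rw [← sum_hpart_eq F hD, map_sum]
  exact Finset.sum_congr rfl fun k _ => ncEval_smul_hpart X t k F

end Eval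

/-! ### Supports of products and homogeneous polynomials -/

/-- `supp (F G) ⊆ supp F · supp G` (products of words). [folklore] -/
theorem support_mul_subset [DecidableEq (FreeMonoid σ)] (F G : NC σ) :
    (F * G).coeff.support ⊆ Finset.image₂ (· * ·) F.coeff.support G.coeff.support := by
  classical
  intro w hw
  rw [Finset.mem_image₂]
  by_contra h
  push Not at h
  apply Finsupp.mem_support_iff.mp hw
  rw [MonoidAlgebra.coeff_mul]
  refine Finset.sum_eq_zero fun u hu => Finset.sum_eq_zero fun v hv => ?_
  exact if_neg (h u hu v hv)

/-- Lengths of words in a product. [folklore] -/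
theorem length_of_mem_support_mul {F G : NC σ} {a b : ℕ}
    (hF : ∀ u ∈ F.coeff.support, u.length = a) (hG : ∀ u ∈ G.coeff.support, u.length = b)
    {w : FreeMonoid σ} (hw : w ∈ (F * G).coeff.support) : w.length = a + b := by
  classical
  obtain ⟨u, hu, v, hv, rfl⟩ := Finset.mem_image₂.mp (support_mul_subset F G hw)
  rw [FreeMonoid.length_mul, hF u hu, hG v hv]

/-- If the words of `F` have length `≤ a` and those of `G` length `≤ b`, the words of `F G` have length `≤ a + b`. [folklore] -/
theorem length_le_of_mem_support_mul {F G : NC σ} {a b : ℕ}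
    (hF : ∀ u ∈ F.coeff.support, u.length ≤ a) (hG : ∀ u ∈ G.coeff.support, u.length ≤ b)
    {w : FreeMonoid σ} (hw : w ∈ (F * G).coeff.support) : w.length ≤ a + b := by
  classical
  obtain ⟨u, hu, v, hv, rfl⟩ := Finset.mem_image₂.mp (support_mul_subset F G hw)
  rw [FreeMonoid.length_mul]; exact Nat.add_le_add (hF u hu) (hG v hv)

/-- A uniform length bound on the words of the summands bounds the words of the sum. [folklore] -/
theorem length_le_of_mem_support_sum {ι : Type*} (s : Finset ι) (f : ι → NC σ) {D : ℕ}
    (h : ∀ i ∈ s, ∀ u ∈ (f i).coeff.support, u.length ≤ D) {w : FreeMonoid σ}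
    (hw : w ∈ (∑ i ∈ s, f i).coeff.support) : w.length ≤ D := by
  classical
  rw [MonoidAlgebra.coeff_sum] at hw
  obtain ⟨i, hi, hwi⟩ := Finset.mem_biUnion.mp (Finsupp.support_finsetSum hw)
  exact h i hi w hwi

/-- Words of `trunc_N F` have length `≤ N`. [folklore] -/
theorem length_le_of_mem_support_truncW {N : ℕ} {F : NC σ} {w : FreeMonoid σ}
    (hw : w ∈ (truncW N F).coeff.support) : w.length ≤ N := by
  rw [truncW, support_wfilter, Finset.mem_filter] at hw
  exact hw.2

/-! ### Words of a multi-index and nc lifts -/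

/-- A word with commutative image `z^α`. [folklore] -/
def wordOf (α : σ →₀ ℕ) : FreeMonoid σ := FreeMonoid.ofList (Finsupp.toMultiset α).toList

/-- The canonical word of a multi-index `α` has length `|α|`. [folklore] -/
theorem length_wordOf (α : σ →₀ ℕ) : (wordOf α).length = α.degree := by
  rw [wordOf, FreeMonoid.length, FreeMonoid.toList_ofList, Multiset.length_toList,
    Finsupp.card_toMultiset, Finsupp.degree_apply, Finsupp.sum]
  rfl

/-- The abelianisation of a word counts the occurrences of each letter. [folklore] -/
theorem toAdd_abw_ofList [DecidableEq σ] (l : List σ) (j : σ) :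
    Multiplicative.toAdd (abw (FreeMonoid.ofList l)) j = l.count j := by
  induction l with
  | nil => rw [FreeMonoid.ofList_nil, map_one, toAdd_one, Finsupp.zero_apply, List.count_nil]
  | cons x xs ih =>
    rw [FreeMonoid.ofList_cons, map_mul, abw, FreeMonoid.lift_eval_of, ← abw, toAdd_mul,
      toAdd_ofAdd, Finsupp.add_apply, ih, List.count_cons, Finsupp.single_apply]
    by_cases h : x = j
    · subst h; simp [add_comm]
    · simp [h]

/-- The canonical word of `α` abelianises to `α`. [folklore] -/
theorem toAdd_abw_wordOf [DecidableEq σ] (α : σ →₀ ℕ) :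
    Multiplicative.toAdd (abw (wordOf α)) = α := by
  ext j
  rw [wordOf, toAdd_abw_ofList, ← Multiset.coe_count, Multiset.coe_toList,
    Finsupp.count_toMultiset]

open MvPolynomial in
/-- `ab` of the word of `α` is the monomial `z^α`. [folklore] -/
theorem ab_single_wordOf [DecidableEq σ] (α : σ →₀ ℕ) (a : ℂ) :
    ab (MonoidAlgebra.single (wordOf α) a) = monomial α a := by
  rw [ab_single, toAdd_abw_wordOf]

/-- **The canonical nc lift** `Σ_{α ∈ S} q_α g^{w(α)}` of the part of a power series supported on a
finite set `S` of multi-indices. [folklore] -/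
def ncLift (S : Finset (σ →₀ ℕ)) (q : MvPowerSeries σ ℂ) : NC σ :=
  ∑ α ∈ S, MonoidAlgebra.single (wordOf α) (MvPowerSeries.coeff α q)

open MvPolynomial in
/-- Coefficients of the abelianised lift: `(ab (ncLift S q))_μ = q_μ` for `μ ∈ S`, else `0`. [folklore] -/
theorem coeff_ab_ncLift [DecidableEq σ] (S : Finset (σ →₀ ℕ)) (q : MvPowerSeries σ ℂ)
    (μ : σ →₀ ℕ) : coeff μ (ab (ncLift S q)) = if μ ∈ S then MvPowerSeries.coeff μ q else 0 := by
  rw [ncLift, map_sum, coeff_sum]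
  simp only [ab_single_wordOf, coeff_monomial]
  rw [Finset.sum_ite_eq']

/-- `|ncLift S q|_ρ ≤ Σ_{α ∈ S} ‖q_α‖ ρ^{|α|}` (`ρ ≥ 0`). [folklore] -/
theorem wnorm_ncLift_le {ρ : ℝ} (hρ : 0 ≤ ρ) (S : Finset (σ →₀ ℕ)) (q : MvPowerSeries σ ℂ) :
    wnorm ρ (ncLift S q) ≤ ∑ α ∈ S, ‖MvPowerSeries.coeff α q‖ * ρ ^ α.degree := by
  refine (wnorm_sum_le hρ _ _).trans (Finset.sum_le_sum fun α _ => ?_)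
  rw [← length_wordOf]
  exact wnorm_single_le ρ _ _

/-- Words of `ncLift S q` have length `≤ N` when `S` consists of multi-indices of degree `≤ N`. [folklore] -/
theorem length_le_of_mem_support_ncLift {S : Finset (σ →₀ ℕ)} {q : MvPowerSeries σ ℂ} {N : ℕ}
    (hS : ∀ α ∈ S, α.degree ≤ N) {w : FreeMonoid σ} (hw : w ∈ (ncLift S q).coeff.support) :
    w.length ≤ N := by
  classical
  refine length_le_of_mem_support_sum S _ (fun α hα u hu => ?_) hw
  rw [MonoidAlgebra.coeff_single] at hu
  rw [Finset.mem_singleton.mp (Finsupp.support_single_subset hu), length_wordOf]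
  exact hS α hα

end Norms

section Lift
open Finset
open scoped Nat

variable {σ : Type}

/-! ### The nc lift of a polynomial with constant term 1 -/

section NcLift

open MvPolynomial

variable [Fintype σ]

/-- Multi-indices of degree `≤ N`. [folklore] -/
def degLE (σ : Type) [Fintype σ] (N : ℕ) : Finset (σ →₀ ℕ) :=
  (Finsupp.finite_of_degree_le (σ := σ) N).toFinset

/-- `α ∈ degLE σ N ↔ |α| ≤ N`. [folklore] -/
theorem mem_degLE {N : ℕ} {α : σ →₀ ℕ} : α ∈ degLE σ N ↔ α.degree ≤ N := by
  rw [degLE, Set.Finite.mem_toFinset, Set.mem_setOf_eq]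

omit [Fintype σ] in
/-- The degree of the commutative image of a word is its length. [folklore] -/
theorem degree_toAdd_abw (u : FreeMonoid σ) : (Multiplicative.toAdd (abw u)).degree = u.length := by
  induction u using FreeMonoid.inductionOn' with
  | one => rw [map_one, toAdd_one, map_zero, FreeMonoid.length_one]
  | mul_of j w ih =>
    rw [map_mul, abw, FreeMonoid.lift_eval_of, ← abw, toAdd_mul, toAdd_ofAdd, map_add, ih,
      Finsupp.degree_single, FreeMonoid.length_mul, FreeMonoid.length_of]

omit [Fintype σ] in
/-- The coefficient of the empty word is the constant coefficient of the abelianisation. [folklore] -/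
theorem coeff_one_eq_constantCoeff_ab (F : NC σ) : F.coeff 1 = constantCoeff (ab F) := by
  classical
  show F.coeff 1 = coeff 0 (ab F)
  rw [coeff_ab]
  have hfilter : F.coeff.support.filter (fun u => Multiplicative.toAdd (abw u) = 0) =
      F.coeff.support.filter (fun u => u = 1) := by
    refine Finset.filter_congr fun u _ => ?_
    rw [← FreeMonoid.length_eq_zero, ← degree_toAdd_abw, Finsupp.degree_eq_zero_iff]
  rw [hfilter]
  rw [Finset.filter_eq' F.coeff.support (1 : FreeMonoid σ)]
  split_ifs with h
  · rw [Finset.sum_singleton]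
  · rw [Finset.sum_empty]; exact Finsupp.notMem_support_iff.mp h

omit [Fintype σ] in
/-- `ab` commutes with truncation. [folklore] -/
theorem coeff_ab_truncW (N : ℕ) (G : NC σ) (μ : σ →₀ ℕ) :
    coeff μ (ab (truncW N G)) = if μ.degree ≤ N then coeff μ (ab G) else 0 := by
  classical
  have hs : (truncW N G).coeff.support ⊆ G.coeff.support := by
    rw [truncW, support_wfilter]; exact Finset.filter_subset _ _
  rw [coeff_ab_of_subset _ μ hs, coeff_ab]
  simp only [coeff_truncW]
  split_ifs with hμ
  · refine Finset.sum_congr rfl fun u hu => ?_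
    rw [Finset.mem_filter] at hu
    rw [if_pos]
    rw [← hu.2, degree_toAdd_abw] at hμ; exact hμ
  · refine Finset.sum_eq_zero fun u hu => ?_
    rw [Finset.mem_filter] at hu
    rw [if_neg]
    rw [← hu.2, degree_toAdd_abw] at hμ; exact hμ

variable [DecidableEq σ]

/-- The nc lift `Ĥ_N = Σ_{|α| ≤ N} h_α g^{w(α)}` of the truncated Euler logarithm `h` of `P`.
[folklore] -/
def hLift (N : ℕ) (P : MvPolynomial σ ℂ) : NC σ :=
  ncLift (degLE σ N) (eulerLog (P : MvPowerSeries σ ℂ))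

/-- The truncated exponential `Σ_{k ≤ N} Ĥ_N^k / k!`. [folklore] -/
def expLift (N : ℕ) (P : MvPolynomial σ ℂ) : NC σ :=
  ∑ k ∈ range (N + 1), ((k ! : ℂ)⁻¹) • hLift N P ^ k

/-- **The nc lift** `P̂_N = trunc_N (Σ_{k ≤ N} Ĥ_N^k / k!)` of `P`. [folklore] -/
def pLift (N : ℕ) (P : MvPolynomial σ ℂ) : NC σ := truncW N (expLift N P)

/-- The lifted truncated logarithm abelianises to the truncated Euler logarithm: `ab Ĥ_N = trunc_{≤ N} (log P)`. [folklore] -/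
theorem ab_hLift (N : ℕ) (P : MvPolynomial σ ℂ) :
    ab (hLift N P) = MvPowerSeries.truncTotal (N + 1) (eulerLog (P : MvPowerSeries σ ℂ)) := by
  ext μ
  rw [hLift, coeff_ab_ncLift, MvPowerSeries.coeff_truncTotal_eq_ite]
  simp only [mem_degLE, Nat.lt_succ_iff]

/-- **`ab P̂_N = P`** once `N ≥ deg P`. [folklore] -/
theorem ab_pLift {N : ℕ} {P : MvPolynomial σ ℂ} (hP : constantCoeff P = 1)
    (hN : P.totalDegree ≤ N) : ab (pLift N P) = P := by
  have hP' : MvPowerSeries.constantCoeff (P : MvPowerSeries σ ℂ) = 1 := by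
    rw [← MvPowerSeries.coeff_zero_eq_constantCoeff_apply, MvPolynomial.coeff_coe]; exact hP
  ext μ
  rw [pLift, coeff_ab_truncW]
  split_ifs with hμ
  · rw [expLift, map_sum, coeff_sum]
    simp only [map_smul, map_pow, coeff_smul, ab_hLift, smul_eq_mul]
    have hμ' : μ.degree < N + 1 := Nat.lt_succ_of_le hμ
    have : ∀ k ∈ range (N + 1),
        (k ! : ℂ)⁻¹ * coeff μ (MvPowerSeries.truncTotal (N + 1)
          (eulerLog (P : MvPowerSeries σ ℂ)) ^ k) =
          MvPowerSeries.coeff μ (eulerLog (P : MvPowerSeries σ ℂ) ^ k) / (k ! : ℂ) := by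
      intro k _
      rw [MvPowerSeries.coeff_truncTotal_pow _ hμ', div_eq_inv_mul]
    rw [Finset.sum_congr rfl this, ← coeff_expf (constantCoeff_eulerLog _) μ hμ,
      expf_eulerLog hP', MvPolynomial.coeff_coe]
  · symm
    apply coeff_eq_zero_of_totalDegree_lt
    rw [← Finsupp.degree_apply]
    omega

/-- `P̂_N` has constant term `1`. [folklore] -/
theorem coeff_one_pLift {N : ℕ} {P : MvPolynomial σ ℂ} (hP : constantCoeff P = 1)
    (hN : P.totalDegree ≤ N) : (pLift N P).coeff 1 = 1 := by
  rw [coeff_one_eq_constantCoeff_ab, ab_pLift hP hN, hP]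

omit [DecidableEq σ] in
/-- Words of the lift `P̂_N` have length `≤ N`. [folklore] -/
theorem length_le_of_mem_support_pLift {N : ℕ} {P : MvPolynomial σ ℂ} {w : FreeMonoid σ}
    (hw : w ∈ (pLift N P).coeff.support) : w.length ≤ N :=
  length_le_of_mem_support_truncW hw

/-! ### Coefficient bounds for the lift -/

omit [Fintype σ] [DecidableEq σ] in
/-- Arithmetic rearrangement used in `sum_norm_coeff_eulerLog_le`. [folklore] -/
private theorem aux_ineq {A B u v pa pb : ℝ} (hq : A⁻¹ * B ≤ 1) (hu : 0 ≤ u) (hv : 0 ≤ v)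
    (hpa : 0 ≤ pa) (hpb : 0 ≤ pb) : A⁻¹ * (B * u * v) * (pa * pb) ≤ u * pa * (v * pb) := by
  have h0 : 0 ≤ u * pa * (v * pb) := by positivity
  calc A⁻¹ * (B * u * v) * (pa * pb) = (A⁻¹ * B) * (u * pa * (v * pb)) := by ring
    _ ≤ 1 * (u * pa * (v * pb)) := mul_le_mul_of_nonneg_right hq h0
    _ = u * pa * (v * pb) := one_mul _

omit [Fintype σ] in
/-- Partial sums of `Σ_α ‖h_α‖ ρ^{|α|}` for the Euler logarithm `h` of `P` are bounded by
`(Σ_β ‖P_β‖ ρ^{|β|}) · G` whenever `G` bounds the partial sums of `Σ_γ ‖(P⁻¹)_γ‖ ρ^{|γ|}`.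
[folklore] -/
theorem sum_norm_coeff_eulerLog_le (P : MvPolynomial σ ℂ) {ρ : ℝ} (hρ : 0 ≤ ρ) {G : ℝ}
    (hG : ∀ T : Finset (σ →₀ ℕ),
      ∑ γ ∈ T, ‖MvPowerSeries.coeff γ ((P : MvPowerSeries σ ℂ)⁻¹)‖ * ρ ^ γ.degree ≤ G)
    (S : Finset (σ →₀ ℕ)) :
    ∑ α ∈ S, ‖MvPowerSeries.coeff α (eulerLog (P : MvPowerSeries σ ℂ))‖ * ρ ^ α.degree ≤
      (∑ β ∈ P.support, ‖coeff β P‖ * ρ ^ β.degree) * G := by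
  obtain ⟨f, hf⟩ : ∃ f : (σ →₀ ℕ) → ℝ, f = fun β => ‖coeff β P‖ * ρ ^ β.degree := ⟨_, rfl⟩
  obtain ⟨g, hg⟩ : ∃ g : (σ →₀ ℕ) → ℝ, g = fun γ =>
    ‖MvPowerSeries.coeff γ ((P : MvPowerSeries σ ℂ)⁻¹)‖ * ρ ^ γ.degree := ⟨_, rfl⟩
  have hG' : ∀ T : Finset (σ →₀ ℕ), ∑ γ ∈ T, g γ ≤ G := by rw [hg]; exact hG
  suffices hmain : ∑ α ∈ S, ‖MvPowerSeries.coeff α (eulerLog (P : MvPowerSeries σ ℂ))‖ *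
      ρ ^ α.degree ≤ (∑ β ∈ P.support, f β) * G by
    rw [hf] at hmain; exact hmain
  have hf0 : ∀ β, 0 ≤ f β := fun β => by rw [hf]; exact mul_nonneg (norm_nonneg _) (pow_nonneg hρ _)
  have hg0 : ∀ γ, 0 ≤ g γ := fun γ => by rw [hg]; exact mul_nonneg (norm_nonneg _) (pow_nonneg hρ _)
  have hG0 : 0 ≤ G := le_trans (by rw [Finset.sum_empty]) (hG ∅)
  -- step 1: termwise bound
  have h1 : ∀ α : σ →₀ ℕ,
      ‖MvPowerSeries.coeff α (eulerLog (P : MvPowerSeries σ ℂ))‖ * ρ ^ α.degree ≤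
        ∑ x ∈ Finset.antidiagonal α, f x.1 * g x.2 := by
    intro α
    rw [coeff_eulerLog, MvPowerSeries.coeff_mul]
    by_cases hα : α = 0
    · rw [hα, map_zero, Nat.cast_zero, inv_zero, zero_mul, norm_zero, zero_mul]
      exact Finset.sum_nonneg fun x _ => mul_nonneg (hf0 _) (hg0 _)
    have hdeg : 0 < (α.degree : ℝ) := by
      exact_mod_cast Nat.pos_of_ne_zero fun h' => hα ((Finsupp.degree_eq_zero_iff α).mp h')
    calc ‖((α.degree : ℕ) : ℂ)⁻¹ * ∑ x ∈ Finset.antidiagonal α,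
            MvPowerSeries.coeff x.1 (euler ↑P) * MvPowerSeries.coeff x.2 (↑P)⁻¹‖ * ρ ^ α.degree
        = (α.degree : ℝ)⁻¹ * ‖∑ x ∈ Finset.antidiagonal α,
            MvPowerSeries.coeff x.1 (euler ↑P) * MvPowerSeries.coeff x.2 (↑P)⁻¹‖ *
            ρ ^ α.degree := by rw [norm_mul, norm_inv, Complex.norm_natCast]
      _ ≤ (α.degree : ℝ)⁻¹ * (∑ x ∈ Finset.antidiagonal α,
            ‖MvPowerSeries.coeff x.1 (euler ↑P) * MvPowerSeries.coeff x.2 (↑P)⁻¹‖) *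
            ρ ^ α.degree :=
          mul_le_mul_of_nonneg_right (mul_le_mul_of_nonneg_left (norm_sum_le _ _)
            (inv_nonneg.mpr hdeg.le)) (pow_nonneg hρ _)
      _ = ∑ x ∈ Finset.antidiagonal α, (α.degree : ℝ)⁻¹ *
            ‖MvPowerSeries.coeff x.1 (euler ↑P) * MvPowerSeries.coeff x.2 (↑P)⁻¹‖ *
            ρ ^ α.degree := by rw [Finset.mul_sum, Finset.sum_mul]
      _ ≤ ∑ x ∈ Finset.antidiagonal α, f x.1 * g x.2 := by
          refine Finset.sum_le_sum fun x hx => ?_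
          rw [Finset.mem_antidiagonal] at hx
          have hx12 : x.1.degree + x.2.degree = α.degree := by
            have := congrArg Finsupp.degree hx
            rwa [_root_.map_add] at this
          have hx1 : (x.1.degree : ℝ) ≤ α.degree := by exact_mod_cast hx12 ▸ Nat.le_add_right _ _
          have hq : (α.degree : ℝ)⁻¹ * x.1.degree ≤ 1 := by
            rw [inv_mul_le_iff₀ hdeg, mul_one]; exact hx1
          have hfx : f x.1 = ‖coeff x.1 P‖ * ρ ^ x.1.degree := by rw [hf]
          have hgx : g x.2 = ‖MvPowerSeries.coeff x.2 ((P : MvPowerSeries σ ℂ)⁻¹)‖ *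
              ρ ^ x.2.degree := by rw [hg]
          have hρpow : ρ ^ α.degree = ρ ^ x.1.degree * ρ ^ x.2.degree := by
            rw [← pow_add, hx12]
          rw [hfx, hgx, hρpow, norm_mul, coeff_euler, norm_mul, Complex.norm_natCast,
            MvPolynomial.coeff_coe]
          exact aux_ineq hq (norm_nonneg _) (norm_nonneg _) (pow_nonneg hρ _) (pow_nonneg hρ _)
  -- step 2: sum over `α ∈ S`
  refine (Finset.sum_le_sum fun α _ => h1 α).trans ?_
  have hdisj : (S : Set (σ →₀ ℕ)).PairwiseDisjoint Finset.antidiagonal := by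
    intro α _ β _ hne
    rw [Function.onFun, Finset.disjoint_left]
    intro x hxα hxβ
    rw [Finset.mem_antidiagonal] at hxα hxβ
    exact hne (hxα.symm.trans hxβ)
  rw [← Finset.sum_biUnion hdisj]
  set U := S.biUnion Finset.antidiagonal with hU
  set B := U.image Prod.fst with hB
  set C := U.image Prod.snd with hC
  calc ∑ x ∈ U, f x.1 * g x.2 ≤ ∑ x ∈ B ×ˢ C, f x.1 * g x.2 :=
        Finset.sum_le_sum_of_subset_of_nonneg Finset.subset_product
          fun x _ _ => mul_nonneg (hf0 _) (hg0 _)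
    _ = (∑ β ∈ B, f β) * ∑ γ ∈ C, g γ := by rw [Finset.sum_product, Finset.sum_mul_sum]
    _ ≤ (∑ β ∈ P.support, f β) * G := by
        refine mul_le_mul ?_ (hG' C) (Finset.sum_nonneg fun γ _ => hg0 γ)
          (Finset.sum_nonneg fun β _ => hf0 β)
        calc ∑ β ∈ B, f β ≤ ∑ β ∈ B ∪ P.support, f β :=
              Finset.sum_le_sum_of_subset_of_nonneg subset_union_left fun β _ _ => hf0 β
          _ = ∑ β ∈ P.support, f β := by
              symm
              refine Finset.sum_subset subset_union_right fun β _ hβ => ?_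
              rw [hf]
              show ‖coeff β P‖ * ρ ^ β.degree = 0
              rw [MvPolynomial.notMem_support_iff.mp hβ, norm_zero, zero_mul]

end NcLift

end Lift

section Invertibility
open Finset
open scoped Nat

variable {σ : Type}

/-! ### Neumann series and truncated exponentials in a Banach algebra -/

section Banach

variable {𝔄 : Type*} [NormedRing 𝔄] [CompleteSpace 𝔄]

/-- Neumann lemma: `‖r‖ ≤ 1/2 ⟹ 1 - r` invertible with `‖(1 - r)⁻¹‖ ≤ 2` (when `‖1‖ ≤ 1`).
[folklore] -/
theorem isUnit_one_sub_of_norm_le (h1 : ‖(1 : 𝔄)‖ ≤ 1) {r : 𝔄} (hr : ‖r‖ ≤ 1 / 2) :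
    IsUnit (1 - r) ∧ ‖Ring.inverse (1 - r)‖ ≤ 2 := by
  have hr1 : ‖r‖ < 1 := by linarith
  refine ⟨by simpa using (Units.oneSub r hr1).isUnit, ?_⟩
  rw [← geom_series_eq_inverse r hr1]
  have h2 : (1 - ‖r‖)⁻¹ ≤ 2 := by
    rw [inv_le_comm₀ (by linarith) (by norm_num : (0 : ℝ) < 2)]; linarith
  linarith [tsum_geometric_le_of_norm_lt_one r hr1]

/-- A two-sided approximate inverse gives a unit. [folklore] -/
theorem isUnit_of_mul_eq_one_add (h1 : ‖(1 : 𝔄)‖ ≤ 1) {a b R R' : 𝔄} (hab : a * b = 1 + R)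
    (hba : b * a = 1 + R') (hR : ‖R‖ ≤ 1 / 2) (hR' : ‖R'‖ ≤ 1 / 2) :
    IsUnit a ∧ ‖Ring.inverse a‖ ≤ 2 * ‖b‖ := by
  obtain ⟨hu, hun⟩ := isUnit_one_sub_of_norm_le h1 (r := -R) (by rwa [norm_neg])
  obtain ⟨hu', -⟩ := isUnit_one_sub_of_norm_le h1 (r := -R') (by rwa [norm_neg])
  rw [sub_neg_eq_add] at hu hun hu'
  -- right inverse `c = b (1+R)⁻¹`, left inverse `d = (1+R')⁻¹ b`
  set c := b * Ring.inverse (1 + R) with hc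
  set d := Ring.inverse (1 + R') * b with hd
  have hac : a * c = 1 := by
    rw [hc, ← mul_assoc, hab, Ring.mul_inverse_cancel _ hu]
  have hda : d * a = 1 := by
    rw [hd, mul_assoc, hba, Ring.inverse_mul_cancel _ hu']
  have hcd : d = c := by
    calc d = d * (a * c) := by rw [hac, mul_one]
      _ = c := by rw [← mul_assoc, hda, one_mul]
  have hunit : IsUnit a := isUnit_iff_exists.mpr ⟨c, hac, hcd ▸ hda⟩
  refine ⟨hunit, ?_⟩
  have hinv : Ring.inverse a = c := by
    calc Ring.inverse a = Ring.inverse a * (a * c) := by rw [hac, mul_one]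
      _ = c := by rw [← mul_assoc, Ring.inverse_mul_cancel _ hunit, one_mul]
  rw [hinv, hc]
  calc ‖b * Ring.inverse (1 + R)‖ ≤ ‖b‖ * ‖Ring.inverse (1 + R)‖ := norm_mul_le _ _
    _ ≤ ‖b‖ * 2 := mul_le_mul_of_nonneg_left hun (norm_nonneg _)
    _ = 2 * ‖b‖ := mul_comm _ _

/-- Perturbation of a unit. [folklore] -/
theorem isUnit_of_norm_sub_le (h1 : ‖(1 : 𝔄)‖ ≤ 1) {a p : 𝔄} {M : ℝ} (ha : IsUnit a)
    (hM : ‖Ring.inverse a‖ ≤ M) (hp : M * ‖a - p‖ ≤ 1 / 2) :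
    IsUnit p ∧ ‖Ring.inverse p‖ ≤ 2 * M := by
  have hM0 : 0 ≤ M := le_trans (norm_nonneg _) hM
  -- `p = a (1 - a⁻¹ (a - p))`
  set r := Ring.inverse a * (a - p) with hr
  have hrn : ‖r‖ ≤ 1 / 2 :=
    le_trans (norm_mul_le _ _) (le_trans (mul_le_mul_of_nonneg_right hM (norm_nonneg _)) hp)
  obtain ⟨hu, hun⟩ := isUnit_one_sub_of_norm_le h1 hrn
  have hp' : p = a * (1 - r) := by
    rw [hr, mul_sub, mul_one, ← mul_assoc, Ring.mul_inverse_cancel _ ha, one_mul, sub_sub_cancel]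
  rw [hp']
  refine ⟨ha.mul hu, ?_⟩
  obtain ⟨u, hu'⟩ := ha
  obtain ⟨v, hv'⟩ := hu
  have huv : a * (1 - r) = ↑(u * v) := by rw [Units.val_mul, hu', hv']
  rw [huv, Ring.inverse_unit, mul_inv_rev, Units.val_mul]
  calc ‖(↑v⁻¹ : 𝔄) * ↑u⁻¹‖ ≤ ‖(↑v⁻¹ : 𝔄)‖ * ‖(↑u⁻¹ : 𝔄)‖ := norm_mul_le _ _
    _ ≤ 2 * M := by
        rw [← Ring.inverse_unit v, ← Ring.inverse_unit u, hv', hu']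
        exact mul_le_mul hun hM (norm_nonneg _) (by norm_num)

variable [NormedAlgebra ℂ 𝔄]

/-- The Cauchy-product coefficients of `e^{X} e^{-X} = 1`. [folklore] -/
theorem sum_antidiagonal_inv_factorial (m : ℕ) :
    ∑ p ∈ Finset.antidiagonal m, (p.1 ! : ℂ)⁻¹ * ((-1) ^ p.2 * (p.2 ! : ℂ)⁻¹) =
      if m = 0 then 1 else 0 := by
  have h := congrArg (PowerSeries.coeff m) (PowerSeries.exp_mul_exp_neg_eq_one (A := ℂ))
  rw [PowerSeries.coeff_mul, PowerSeries.coeff_one] at h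
  rw [← h]
  refine Finset.sum_congr rfl fun p _ => ?_
  simp [PowerSeries.coeff_exp, PowerSeries.evalNegHom, PowerSeries.coeff_rescale]

/-- Truncated exponential `a_N(x) = Σ_{k ≤ N} x^k / k!`. [folklore] -/
def texp (N : ℕ) (x : 𝔄) : 𝔄 := ∑ k ∈ range (N + 1), ((k ! : ℂ)⁻¹) • x ^ k

omit [CompleteSpace 𝔄] in
/-- `(-x)^l = (-1)^l • x^l` in a complex algebra. [folklore] -/
theorem neg_pow_eq_smul (x : 𝔄) (l : ℕ) : (-x) ^ l = ((-1 : ℂ) ^ l) • x ^ l := by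
  induction l with
  | zero => rw [pow_zero, pow_zero, pow_zero, one_smul]
  | succ l ih => rw [pow_succ, ih, pow_succ, pow_succ, smul_mul_assoc, mul_neg, mul_neg_one,
      neg_smul, smul_neg]

omit [CompleteSpace 𝔄] in
/-- `texp N (-x) = Σ_{l ≤ N} ((-1)^l / l!) • x^l`. [folklore] -/
theorem texp_neg (N : ℕ) (x : 𝔄) :
    texp N (-x) = ∑ l ∈ range (N + 1), ((-1) ^ l * (l ! : ℂ)⁻¹) • x ^ l := by
  refine Finset.sum_congr rfl fun l _ => ?_
  rw [neg_pow_eq_smul, smul_smul, mul_comm]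

omit [CompleteSpace 𝔄] [NormedAlgebra ℂ 𝔄] in
/-- `‖x^k‖ ≤ B^k` when `‖x‖ ≤ B` and `‖1‖ ≤ 1`. [folklore] -/
theorem norm_pow_le_pow {x : 𝔄} {B : ℝ} (hx : ‖x‖ ≤ B) (h1 : ‖(1 : 𝔄)‖ ≤ 1) (k : ℕ) :
    ‖x ^ k‖ ≤ B ^ k := by
  cases k with
  | zero => rw [pow_zero, pow_zero]; exact h1
  | succ k =>
    exact le_trans (norm_pow_le' x (Nat.succ_pos k)) (pow_le_pow_left₀ (norm_nonneg _) hx _)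

omit [CompleteSpace 𝔄] in
/-- `‖texp N x‖ ≤ e^B` when `‖x‖ ≤ B` and `‖1‖ ≤ 1`. [folklore] -/
theorem norm_texp_le (N : ℕ) {x : 𝔄} {B : ℝ} (hx : ‖x‖ ≤ B) (h1 : ‖(1 : 𝔄)‖ ≤ 1) :
    ‖texp N x‖ ≤ Real.exp B := by
  have hB : 0 ≤ B := le_trans (norm_nonneg _) hx
  refine le_trans (norm_sum_le _ _) (le_trans (Finset.sum_le_sum fun k _ => ?_)
    (Real.sum_le_exp_of_nonneg hB (N + 1)))
  rw [norm_smul, norm_inv, Complex.norm_natCast, div_eq_inv_mul]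
  exact mul_le_mul_of_nonneg_left (norm_pow_le_pow hx h1 k) (inv_nonneg.mpr (Nat.cast_nonneg _))

omit [CompleteSpace 𝔄] in
/-- `‖a_N(x) a_N(-x) - 1‖ ≤ e^{4B} / 2^{N+1}` for `‖x‖ ≤ B`. [folklore] -/
theorem norm_texp_mul_texp_neg_sub_one_le (N : ℕ) {x : 𝔄} {B : ℝ} (hx : ‖x‖ ≤ B)
    (h1 : ‖(1 : 𝔄)‖ ≤ 1) :
    ‖texp N x * texp N (-x) - 1‖ ≤ Real.exp (4 * B) / 2 ^ (N + 1) := by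
  have hB : 0 ≤ B := le_trans (norm_nonneg _) hx
  obtain ⟨c, hc⟩ : ∃ c : ℕ × ℕ → ℂ, c = fun p => (p.1 ! : ℂ)⁻¹ * ((-1) ^ p.2 * (p.2 ! : ℂ)⁻¹) :=
    ⟨_, rfl⟩
  set S := range (N + 1) ×ˢ range (N + 1) with hS
  have hprod : texp N x * texp N (-x) = ∑ p ∈ S, c p • x ^ (p.1 + p.2) := by
    rw [texp_neg, texp, Finset.sum_mul_sum, Finset.sum_product]
    refine Finset.sum_congr rfl fun k _ => Finset.sum_congr rfl fun l _ => ?_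
    rw [smul_mul_smul_comm, ← pow_add, hc]
  -- the part with `k + l ≤ N` is `1`
  have hpart1 : ∑ p ∈ S with p.1 + p.2 ≤ N, c p • x ^ (p.1 + p.2) = 1 := by
    rw [← Finset.sum_fiberwise_of_maps_to (s := S.filter fun p => p.1 + p.2 ≤ N)
      (t := range (N + 1)) (g := fun p => p.1 + p.2)
      (fun p hp => by rw [Finset.mem_filter] at hp; exact mem_range.mpr (Nat.lt_succ_of_le hp.2))]
    have hfib : ∀ m ∈ range (N + 1),
        (S.filter fun p => p.1 + p.2 ≤ N).filter (fun p => p.1 + p.2 = m) =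
          Finset.antidiagonal m := by
      intro m hm
      rw [mem_range] at hm
      ext p
      simp only [hS, Finset.mem_filter, Finset.mem_product, Finset.mem_range,
        Finset.mem_antidiagonal]
      omega
    rw [Finset.sum_congr rfl fun m hm => by rw [hfib m hm]]
    have hinner : ∀ m ∈ range (N + 1), ∑ p ∈ Finset.antidiagonal m, c p • x ^ (p.1 + p.2) =
        if m = 0 then (1 : 𝔄) else 0 := by
      intro m _
      rw [Finset.sum_congr rfl fun p hp => by rw [Finset.mem_antidiagonal.mp hp],
        ← Finset.sum_smul, hc, sum_antidiagonal_inv_factorial]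
      split_ifs with h
      · rw [h, pow_zero, one_smul]
      · rw [zero_smul]
    rw [Finset.sum_congr rfl hinner, Finset.sum_ite_eq']
    simp
  -- the rest is small
  have hpart2 : ‖∑ p ∈ S with ¬ p.1 + p.2 ≤ N, c p • x ^ (p.1 + p.2)‖ ≤
      Real.exp (4 * B) / 2 ^ (N + 1) := by
    have hterm : ∀ p ∈ S.filter (fun p => ¬ p.1 + p.2 ≤ N),
        ‖c p • x ^ (p.1 + p.2)‖ ≤
          (2 ^ (N + 1))⁻¹ * (((2 * B) ^ p.1 / p.1 !) * ((2 * B) ^ p.2 / p.2 !)) := by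
      intro p hp
      rw [Finset.mem_filter] at hp
      have hkl : N + 1 ≤ p.1 + p.2 := Nat.lt_of_not_le hp.2
      rw [norm_smul, hc]
      simp only
      rw [norm_mul, norm_mul, norm_inv, norm_inv, Complex.norm_natCast, Complex.norm_natCast,
        norm_pow, norm_neg, norm_one, one_pow, one_mul]
      have h2 : (1 : ℝ) ≤ (2 ^ (N + 1))⁻¹ * 2 ^ (p.1 + p.2) := by
        rw [le_inv_mul_iff₀ (by positivity), mul_one]
        exact pow_le_pow_right₀ (by norm_num) hkl
      calc (p.1 ! : ℝ)⁻¹ * (p.2 ! : ℝ)⁻¹ * ‖x ^ (p.1 + p.2)‖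
          ≤ (p.1 ! : ℝ)⁻¹ * (p.2 ! : ℝ)⁻¹ * B ^ (p.1 + p.2) :=
            mul_le_mul_of_nonneg_left (norm_pow_le_pow hx h1 _) (by positivity)
        _ = 1 * ((p.1 ! : ℝ)⁻¹ * (p.2 ! : ℝ)⁻¹ * B ^ (p.1 + p.2)) := (one_mul _).symm
        _ ≤ ((2 ^ (N + 1))⁻¹ * 2 ^ (p.1 + p.2)) *
            ((p.1 ! : ℝ)⁻¹ * (p.2 ! : ℝ)⁻¹ * B ^ (p.1 + p.2)) :=
            mul_le_mul_of_nonneg_right h2 (by positivity)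
        _ = (2 ^ (N + 1))⁻¹ * (((2 * B) ^ p.1 / p.1 !) * ((2 * B) ^ p.2 / p.2 !)) := by
            rw [mul_pow, pow_add, pow_add]; field_simp; ring
    refine le_trans (norm_sum_le _ _) (le_trans (Finset.sum_le_sum hterm) ?_)
    rw [← Finset.mul_sum]
    have hsub : ∑ p ∈ S with ¬ p.1 + p.2 ≤ N, ((2 * B) ^ p.1 / p.1 !) * ((2 * B) ^ p.2 / p.2 !) ≤
        ∑ p ∈ S, ((2 * B) ^ p.1 / p.1 !) * ((2 * B) ^ p.2 / p.2 !) :=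
      Finset.sum_le_sum_of_subset_of_nonneg (Finset.filter_subset _ _)
        fun p _ _ => by positivity
    have hS' : ∑ p ∈ S, ((2 * B) ^ p.1 / p.1 !) * ((2 * B) ^ p.2 / p.2 !) ≤
        Real.exp (2 * B) * Real.exp (2 * B) := by
      rw [hS, Finset.sum_product]
      dsimp only
      rw [← Finset.sum_mul_sum]
      have hle := Real.sum_le_exp_of_nonneg (by positivity : 0 ≤ 2 * B) (N + 1)
      exact mul_le_mul hle hle (Finset.sum_nonneg fun i _ => by positivity) (Real.exp_nonneg _)
    rw [← Real.exp_add, show 2 * B + 2 * B = 4 * B by ring] at hS'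
    rw [div_eq_inv_mul]
    exact mul_le_mul_of_nonneg_left (hsub.trans hS') (by positivity)
  rw [hprod, ← Finset.sum_filter_add_sum_filter_not S (fun p => p.1 + p.2 ≤ N), hpart1,
    add_sub_cancel_left]
  exact hpart2

/-- **Truncated exponentials are invertible**: for `‖x‖ ≤ B` and `e^{4B}/2^{N+1} ≤ 1/2`,
`a_N(x)` is a unit with `‖a_N(x)⁻¹‖ ≤ 2 e^{B}`. [folklore] -/
theorem isUnit_texp (h1 : ‖(1 : 𝔄)‖ ≤ 1) (N : ℕ) {x : 𝔄} {B : ℝ} (hx : ‖x‖ ≤ B)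
    (hN : Real.exp (4 * B) / 2 ^ (N + 1) ≤ 1 / 2) :
    IsUnit (texp N x) ∧ ‖Ring.inverse (texp N x)‖ ≤ 2 * Real.exp B := by
  have hx' : ‖-x‖ ≤ B := by rwa [norm_neg]
  have hab := norm_texp_mul_texp_neg_sub_one_le N hx h1
  have hba := norm_texp_mul_texp_neg_sub_one_le N hx' h1
  rw [neg_neg] at hba
  obtain ⟨hu, hn⟩ := isUnit_of_mul_eq_one_add h1 (R := texp N x * texp N (-x) - 1)
    (R' := texp N (-x) * texp N x - 1) (by abel) (by abel) (hab.trans hN) (hba.trans hN)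
  exact ⟨hu, hn.trans (mul_le_mul_of_nonneg_left (norm_texp_le N hx' h1) (by norm_num))⟩

end Banach

/-! ### The truncated inverse series `Q_K` and the remainder `R_K = Q_K P̂ - 1` -/

section QSeries

/-- `Q_K = trunc_K Σ_{j ≤ K} (1 - P̂)^j`: the words of length `≤ K` of the formal inverse of `P̂`.
[folklore] -/
def qapprox (K : ℕ) (Pn : NC σ) : NC σ := truncW K (∑ j ∈ range (K + 1), (-(Pn - 1)) ^ j)

/-- The remainder `R_K = Q_K P̂ - 1`. [folklore] -/
def rrem (K : ℕ) (Pn : NC σ) : NC σ := qapprox K Pn * Pn - 1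

/-- If the words of `F` have length `≥ a` and those of `G` length `≥ b`, the words of `F G` have length `≥ a + b`. [folklore] -/
theorem le_length_of_mem_support_mul {F G : NC σ} {a b : ℕ}
    (hF : ∀ u ∈ F.coeff.support, a ≤ u.length) (hG : ∀ u ∈ G.coeff.support, b ≤ u.length)
    {w : FreeMonoid σ} (hw : w ∈ (F * G).coeff.support) : a + b ≤ w.length := by
  classical
  obtain ⟨u, hu, v, hv, rfl⟩ := Finset.mem_image₂.mp (support_mul_subset F G hw)
  rw [FreeMonoid.length_mul]; exact Nat.add_le_add (hF u hu) (hG v hv)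

/-- If `F` has no constant term, the words of `F^j` have length `≥ j`. [folklore] -/
theorem le_length_of_mem_support_pow {F : NC σ} (hF : ∀ u ∈ F.coeff.support, 1 ≤ u.length)
    (j : ℕ) {w : FreeMonoid σ} (hw : w ∈ (F ^ j).coeff.support) : j ≤ w.length := by
  induction j generalizing w with
  | zero => exact Nat.zero_le _
  | succ j ih =>
    rw [pow_succ] at hw
    have := le_length_of_mem_support_mul (a := j) (b := 1) (fun u hu => ih hu) hF hw
    omega

/-- If the words of `F` have length `≤ D`, the words of `F^j` have length `≤ j D`. [folklore] -/
theorem length_le_of_mem_support_pow {F : NC σ} {D : ℕ} (hF : ∀ u ∈ F.coeff.support, u.length ≤ D)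
    (j : ℕ) {w : FreeMonoid σ} (hw : w ∈ (F ^ j).coeff.support) : w.length ≤ j * D := by
  induction j generalizing w with
  | zero =>
    rw [pow_zero, MonoidAlgebra.one_def, MonoidAlgebra.coeff_single] at hw
    rw [Finset.mem_singleton.mp (Finsupp.support_single_subset hw), FreeMonoid.length_one]
    exact Nat.zero_le _
  | succ j ih =>
    rw [pow_succ] at hw
    have := length_le_of_mem_support_mul (a := j * D) (b := D) (fun u hu => ih hu) hF hw
    rw [Nat.succ_mul]; exact this

/-- `supp (-F) = supp F`. [folklore] -/
theorem mem_support_neg {F : NC σ} {w : FreeMonoid σ} : w ∈ (-F).coeff.support ↔ w ∈ F.coeff.support := by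
  rw [MonoidAlgebra.coeff_neg, Finsupp.support_neg]

/-- `supp (F + G) ⊆ supp F ∪ supp G`. [folklore] -/
theorem mem_support_add {F G : NC σ} {w : FreeMonoid σ} (hw : w ∈ (F + G).coeff.support) :
    w ∈ F.coeff.support ∨ w ∈ G.coeff.support := by
  classical
  rw [MonoidAlgebra.coeff_add] at hw
  exact Finset.mem_union.mp (Finsupp.support_add hw)

/-- `supp (F - G) ⊆ supp F ∪ supp G`. [folklore] -/
theorem mem_support_sub {F G : NC σ} {w : FreeMonoid σ} (hw : w ∈ (F - G).coeff.support) :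
    w ∈ F.coeff.support ∨ w ∈ G.coeff.support := by
  rw [sub_eq_add_neg] at hw
  rcases mem_support_add hw with h | h
  · exact Or.inl h
  · exact Or.inr (mem_support_neg.mp h)

/-- The words of `P̂ - 1` are nonempty when `P̂` has constant term `1`. [folklore] -/
theorem one_le_length_of_mem_support_sub_one {Pn : NC σ} (hP1 : Pn.coeff 1 = 1)
    {w : FreeMonoid σ} (hw : w ∈ (Pn - 1).coeff.support) : 1 ≤ w.length := by
  rw [Nat.one_le_iff_ne_zero, Ne, FreeMonoid.length_eq_zero]
  rintro rfl
  rw [Finsupp.mem_support_iff, MonoidAlgebra.coeff_sub, Finsupp.sub_apply, hP1,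
    MonoidAlgebra.one_def, MonoidAlgebra.coeff_single, Finsupp.single_eq_same, sub_self] at hw
  exact hw rfl

/-- **(R1)** The remainder `R_K` only has words of length `≥ K+1`. [folklore] -/
theorem succ_le_length_of_mem_support_rrem {Pn : NC σ} (hP1 : Pn.coeff 1 = 1) (K : ℕ)
    {w : FreeMonoid σ} (hw : w ∈ (rrem K Pn).coeff.support) : K + 1 ≤ w.length := by
  set T := Pn - 1 with hT
  set G := ∑ j ∈ range (K + 1), (-T) ^ j with hG
  have hgeom : G * Pn = 1 - (-T) ^ (K + 1) := by
    have := geom_sum_mul_neg (-T) (K + 1)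
    rwa [sub_neg_eq_add, hT, add_sub_cancel] at this
  have hsplit : rrem K Pn = -(-T) ^ (K + 1) - wfilter (fun u => ¬ u.length ≤ K) G * Pn := by
    have hQ : qapprox K Pn = G - wfilter (fun u => ¬ u.length ≤ K) G := by
      rw [qapprox, ← hT, ← hG, eq_sub_iff_add_eq]; exact wfilter_add_wfilter_not _ G
    rw [rrem, hQ, sub_mul, hgeom]; abel
  rw [hsplit] at hw
  rcases mem_support_sub hw with h | h
  · rw [mem_support_neg] at h
    have hT1 : ∀ u ∈ (-T).coeff.support, 1 ≤ u.length := fun u hu =>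
      one_le_length_of_mem_support_sub_one hP1 (mem_support_neg.mp hu)
    exact le_length_of_mem_support_pow hT1 (K + 1) h
  · have h1 : ∀ u ∈ (wfilter (fun u => ¬ u.length ≤ K) G).coeff.support, K + 1 ≤ u.length := by
      intro u hu
      rw [support_wfilter, Finset.mem_filter] at hu
      omega
    have := le_length_of_mem_support_mul (b := 0) h1 (fun u _ => Nat.zero_le _) h
    omega

/-- Words of `Q_K` have length `≤ K`. [folklore] -/
theorem length_le_of_mem_support_qapprox {Pn : NC σ} {K : ℕ} {w : FreeMonoid σ}
    (hw : w ∈ (qapprox K Pn).coeff.support) : w.length ≤ K :=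
  length_le_of_mem_support_truncW hw

/-- The remainder `R_K` only has words of length `≤ K + D`. [folklore] -/
theorem length_le_of_mem_support_rrem {Pn : NC σ} {D : ℕ} (hD : ∀ u ∈ Pn.coeff.support, u.length ≤ D)
    (K : ℕ) {w : FreeMonoid σ} (hw : w ∈ (rrem K Pn).coeff.support) : w.length ≤ K + D := by
  rcases mem_support_sub hw with h | h
  · exact length_le_of_mem_support_mul (fun u hu => length_le_of_mem_support_qapprox hu) hD h
  · rw [MonoidAlgebra.one_def, MonoidAlgebra.coeff_single] at h
    rw [Finset.mem_singleton.mp (Finsupp.support_single_subset h), FreeMonoid.length_one]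
    exact Nat.zero_le _

/-! ### Homogeneous parts of products -/

/-- `wfilter p F = 0` when no word of the support satisfies `p`. [folklore] -/
theorem wfilter_eq_zero_of_forall (p : FreeMonoid σ → Prop) [DecidablePred p] (F : NC σ)
    (h : ∀ u ∈ F.coeff.support, ¬ p u) : wfilter p F = 0 := by
  apply MonoidAlgebra.coeff_injective
  ext w
  rw [coeff_wfilter, MonoidAlgebra.coeff_zero, Finsupp.zero_apply]
  split_ifs with hw
  · by_contra hne
    exact h w (Finsupp.mem_support_iff.mpr hne) hw
  · rfl

/-- `F_k = F` when `F` is homogeneous of degree `k`. [folklore] -/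
theorem hpart_eq_self_of_forall {k : ℕ} {F : NC σ} (h : ∀ u ∈ F.coeff.support, u.length = k) :
    hpart k F = F := wfilter_true_of_forall _ F h

/-- `F_k = 0` when no word of `F` has length `k`. [folklore] -/
theorem hpart_eq_zero_of_forall {k : ℕ} {F : NC σ} (h : ∀ u ∈ F.coeff.support, u.length ≠ k) :
    hpart k F = 0 := wfilter_eq_zero_of_forall _ F h

/-- `(F_a G_b)_m = F_a G_b` if `a + b = m`, else `0`. [folklore] -/
theorem hpart_hpart_mul_hpart (m a b : ℕ) (F G : NC σ) :
    hpart m (hpart a F * hpart b G) = if a + b = m then hpart a F * hpart b G else 0 := by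
  have hlen : ∀ w ∈ (hpart a F * hpart b G).coeff.support, w.length = a + b := fun w hw =>
    length_of_mem_support_mul (fun u hu => mem_support_hpart hu) (fun u hu => mem_support_hpart hu) hw
  split_ifs with h
  · exact hpart_eq_self_of_forall fun w hw => (hlen w hw).trans h
  · exact hpart_eq_zero_of_forall fun w hw => (hlen w hw).symm ▸ h

/-- `F_k = 0` for `k` beyond the length of every word of `F`. [folklore] -/
theorem hpart_eq_zero_of_lt {k D : ℕ} {F : NC σ} (hF : ∀ u ∈ F.coeff.support, u.length ≤ D)
    (hk : D < k) : hpart k F = 0 :=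
  hpart_eq_zero_of_forall fun u hu h => by have := hF u hu; omega

/-- **Homogeneous parts of a product**: `(FG)_m = Σ_{a+b=m} F_a G_b`. [folklore] -/
theorem hpart_mul (m : ℕ) (F G : NC σ) :
    hpart m (F * G) = ∑ p ∈ Finset.antidiagonal m, hpart p.1 F * hpart p.2 G := by
  classical
  set A := F.coeff.support.sup FreeMonoid.length with hA
  set B := G.coeff.support.sup FreeMonoid.length with hB
  have hFA : ∀ u ∈ F.coeff.support, u.length ≤ A := fun u hu => Finset.le_sup (f := FreeMonoid.length) hu
  have hGB : ∀ u ∈ G.coeff.support, u.length ≤ B := fun u hu => Finset.le_sup (f := FreeMonoid.length) hu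
  conv_lhs => rw [← sum_hpart_eq F hFA, ← sum_hpart_eq G hGB, Finset.sum_mul_sum, map_sum]
  simp only [map_sum, hpart_hpart_mul_hpart]
  -- both sides are the sum over `{(a,b) : a + b = m, a ≤ A, b ≤ B}`
  rw [← Finset.sum_product', Finset.sum_ite, Finset.sum_const_zero, add_zero]
  symm
  rw [← Finset.sum_filter_add_sum_filter_not (Finset.antidiagonal m) (fun p => p.1 ≤ A ∧ p.2 ≤ B)]
  have hzero : ∑ p ∈ Finset.antidiagonal m with ¬ (p.1 ≤ A ∧ p.2 ≤ B), hpart p.1 F * hpart p.2 G = 0 := by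
    refine Finset.sum_eq_zero fun p hp => ?_
    rw [Finset.mem_filter, not_and_or, not_le, not_le] at hp
    rcases hp.2 with h | h
    · rw [hpart_eq_zero_of_lt hFA h, zero_mul]
    · rw [hpart_eq_zero_of_lt hGB h, mul_zero]
  rw [hzero, add_zero]
  refine Finset.sum_congr ?_ fun _ _ => rfl
  ext p
  simp only [Finset.mem_filter, Finset.mem_antidiagonal, Finset.mem_product, Finset.mem_range]
  omega

/-- For `m ≥ 1`, `(R_K)_m = Σ_{a+b=m} (Q_K)_a P̂_b`. [folklore] -/
theorem hpart_rrem {m : ℕ} (hm : 1 ≤ m) (K : ℕ) (Pn : NC σ) :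
    hpart m (rrem K Pn) = ∑ p ∈ Finset.antidiagonal m, hpart p.1 (qapprox K Pn) * hpart p.2 Pn := by
  rw [rrem, map_sub, hpart_mul, sub_eq_self]
  refine hpart_eq_zero_of_forall fun u hu => ?_
  rw [MonoidAlgebra.one_def, MonoidAlgebra.coeff_single] at hu
  rw [Finset.mem_singleton.mp (Finsupp.support_single_subset hu), FreeMonoid.length_one]
  omega

/-- The remainder `R_K = Q_K P̂ - 1` has no homogeneous component of degree `≤ K` (when `P̂_∅ = 1`). [folklore] -/
theorem hpart_rrem_eq_zero {m K : ℕ} (hm : m ≤ K) {Pn : NC σ} (hP1 : Pn.coeff 1 = 1) :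
    hpart m (rrem K Pn) = 0 :=
  hpart_eq_zero_of_forall fun u hu h => by
    have := succ_le_length_of_mem_support_rrem hP1 K hu; omega

/-- `Q_K` has no homogeneous component of degree `> K`. [folklore] -/
theorem hpart_qapprox_eq_zero {k K : ℕ} (hk : K < k) (Pn : NC σ) : hpart k (qapprox K Pn) = 0 :=
  hpart_eq_zero_of_lt (fun _ hu => length_le_of_mem_support_qapprox hu) hk

end QSeries

/-! ### The circle estimate for the homogeneous parts of `Q_K` -/

section Circle

open Complex MeasureTheory Metric Set
open scoped Real

/-- Coefficient extraction for vector-valued trigonometric polynomials: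
`∮_{|t|=R} t^{-(m+1)} Σ_i t^{e_i} c_i dt = 2πi Σ_{e_i = m} c_i`. [folklore] -/
theorem circleIntegral_zpow_smul_sum_pow_smul {E : Type*} [NormedAddCommGroup E] [NormedSpace ℂ E]
    [CompleteSpace E] {ι : Type*} (S : Finset ι) (c : ι → E) (e : ι → ℕ) (m : ℕ) {R : ℝ}
    (hR : 0 < R) :
    (∮ t in C(0, R), t ^ (-(m + 1 : ℤ)) • ∑ i ∈ S, t ^ e i • c i) =
      (2 * π * I) • ∑ i ∈ S with e i = m, c i := by
  classical
  have hsphere : ∀ t ∈ sphere (0 : ℂ) R, t ≠ 0 := fun t ht h0 => by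
    rw [h0, mem_sphere, dist_self] at ht
    exact hR.ne' ht.symm
  have hcongr : EqOn (fun t : ℂ => t ^ (-(m + 1 : ℤ)) • ∑ i ∈ S, t ^ e i • c i)
      (fun t => ∑ i ∈ S, (t - 0) ^ ((e i : ℤ) - (m + 1)) • c i) (sphere (0 : ℂ) R) := by
    intro t ht
    simp only [sub_zero, Finset.smul_sum, smul_smul]
    refine Finset.sum_congr rfl fun i _ => ?_
    rw [zpow_sub₀ (hsphere t ht), zpow_natCast, zpow_neg, div_eq_mul_inv, mul_comm]
  rw [circleIntegral.integral_congr hR.le hcongr]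
  have h0R : (0 : ℂ) ∉ sphere (0 : ℂ) |R| := fun h => hsphere 0 (by rwa [abs_of_pos hR] at h) rfl
  have hint : ∀ i ∈ S, CircleIntegrable (fun t : ℂ => (t - 0) ^ ((e i : ℤ) - (m + 1)) • c i) 0 R := by
    intro i _
    refine ContinuousOn.circleIntegrable hR.le (ContinuousOn.smul ?_ continuousOn_const)
    exact ContinuousOn.zpow₀ (continuousOn_id.sub continuousOn_const) _
      fun t ht => Or.inl (by simpa using hsphere t ht)
  rw [circleIntegral.integral_fun_sum hint]
  have hterm : ∀ i ∈ S, (∮ t in C(0, R), (t - 0) ^ ((e i : ℤ) - (m + 1)) • c i) =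
      if e i = m then (2 * π * I) • c i else 0 := by
    intro i _
    rw [circleIntegral.integral_smul_const]
    split_ifs with him
    · have : ((e i : ℤ) - (m + 1)) = -1 := by rw [him]; ring
      rw [this]
      simp only [zpow_neg, zpow_one]
      rw [circleIntegral.integral_sub_inv_of_mem_ball (mem_ball_self hR)]
    · rw [circleIntegral.integral_sub_zpow_of_ne, zero_smul]
      intro h
      apply him
      have : (e i : ℤ) = m := by linarith
      exact_mod_cast this
  rw [Finset.sum_congr rfl hterm, ← Finset.sum_filter, Finset.smul_sum]

variable {𝔄 : Type*} [NormedRing 𝔄] [NormedAlgebra ℂ 𝔄] [CompleteSpace 𝔄]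

omit [CompleteSpace 𝔄] in
/-- A vector-valued polynomial in `t` is differentiable. [folklore] -/
theorem differentiable_sum_pow_smul {ι : Type*} (S : Finset ι) (e : ι → ℕ) (c : ι → 𝔄) :
    Differentiable ℂ fun t : ℂ => ∑ i ∈ S, t ^ e i • c i := by
  refine Differentiable.fun_sum fun i _ => ?_
  exact (differentiable_pow (e i)).smul_const (c i)

/-- **The circle estimate.** If `P̂(Y)` is invertible with `‖P̂(Y)⁻¹‖ ≤ M₂` whenever `‖Y_j‖ ≤ ρ'`,
then for `‖X_j‖ ≤ 1` the homogeneous parts of `Q_K` satisfy `‖(Q_K)_k(X)‖ ≤ M₂ ρ'^{-k}`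
(`(Q_K)_k(X)` is the `k`-th Taylor coefficient of `t ↦ P̂(tX)⁻¹`). [folklore] -/
theorem norm_ncEval_hpart_qapprox_le {Pn : NC σ} (hP1 : Pn.coeff 1 = 1)
    {D : ℕ} (hD : ∀ u ∈ Pn.coeff.support, u.length ≤ D) {ρ' M₂ : ℝ} (hρ' : 0 < ρ')
    (hinv : ∀ Y : σ → 𝔄, (∀ j, ‖Y j‖ ≤ ρ') →
      IsUnit (ncEval Y Pn) ∧ ‖Ring.inverse (ncEval Y Pn)‖ ≤ M₂)
    (X : σ → 𝔄) (hX : ∀ j, ‖X j‖ ≤ 1) {K k : ℕ} (hk : k ≤ K) :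
    ‖ncEval X (hpart k (qapprox K Pn))‖ ≤ M₂ * ρ'⁻¹ ^ k := by
  set Q := qapprox K Pn with hQ
  set R := rrem K Pn with hR
  -- the three polynomials in `t`
  set f : ℂ → 𝔄 := fun t => ∑ i ∈ range (K + 1), t ^ i • ncEval X (hpart i Q) with hf
  set g : ℂ → 𝔄 := fun t => ∑ i ∈ range (D + 1), t ^ i • ncEval X (hpart i Pn) with hg
  set rr : ℂ → 𝔄 := fun t => ∑ i ∈ Finset.Ico (K + 1) (K + D + 1),
    t ^ (i - (K + 1)) • ncEval X (hpart i R) with hrr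
  have hfE : ∀ t, f t = ncEval (fun j => t • X j) Q := fun t =>
    (ncEval_smul_eq_sum X t Q fun u hu => length_le_of_mem_support_qapprox hu).symm
  have hgE : ∀ t, g t = ncEval (fun j => t • X j) Pn := fun t => (ncEval_smul_eq_sum X t Pn hD).symm
  have hRE : ∀ t, ncEval (fun j => t • X j) R = t ^ (K + 1) • rr t := by
    intro t
    rw [ncEval_smul_eq_sum X t R (fun u hu => length_le_of_mem_support_rrem hD K hu), hrr]
    simp only [Finset.smul_sum, smul_smul, ← pow_add]
    rw [Finset.range_eq_Ico, ← Finset.sum_Ico_consecutive _ (Nat.zero_le (K + 1)) (by omega)]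
    rw [Finset.sum_eq_zero (s := Finset.Ico 0 (K + 1)), zero_add]
    · refine Finset.sum_congr rfl fun i hi => ?_
      rw [Finset.mem_Ico] at hi
      rw [show K + 1 + (i - (K + 1)) = i by omega]
    · intro i hi
      rw [Finset.mem_Ico] at hi
      rw [hR, hpart_rrem_eq_zero (by omega) hP1, map_zero, smul_zero]
  have hfg : ∀ t, f t * g t = 1 + t ^ (K + 1) • rr t := by
    intro t
    rw [hfE, hgE, ← map_mul, ← hRE, hR, rrem, map_sub, map_one, hQ]; abel
  -- units on the closed disc
  have hunit : ∀ t : ℂ, ‖t‖ ≤ ρ' → IsUnit (g t) ∧ ‖Ring.inverse (g t)‖ ≤ M₂ := by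
    intro t ht
    rw [hgE]
    refine hinv _ fun j => ?_
    rw [norm_smul]
    exact le_trans (mul_le_mul ht (hX j) (norm_nonneg _) (le_trans (norm_nonneg _) ht)) (mul_one _).le
  -- differentiability
  have hgd : Differentiable ℂ g := differentiable_sum_pow_smul _ _ _
  have hrd : Differentiable ℂ rr := differentiable_sum_pow_smul _ _ _
  have hId : ∀ t : ℂ, ‖t‖ ≤ ρ' → DifferentiableAt ℂ (fun s => rr s * Ring.inverse (g s)) t := by
    intro t ht
    exact (hrd t).mul ((differentiableAt_inverse (hunit t ht).1).comp t (hgd t))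
  have hIc : ContinuousOn (fun s => rr s * Ring.inverse (g s)) (closedBall (0 : ℂ) ρ') := by
    intro t ht
    rw [mem_closedBall, dist_zero_right] at ht
    exact (hId t ht).continuousAt.continuousWithinAt
  -- Cauchy: the holomorphic part integrates to zero
  have hzero : (∮ t in C(0, ρ'), t ^ (K - k) • (rr t * Ring.inverse (g t))) = 0 := by
    refine circleIntegral_eq_zero_of_differentiable_on_off_countable hρ'.le countable_empty
      ((continuousOn_id.pow _).smul hIc) fun t ht => ?_
    rw [sdiff_empty, mem_ball, dist_zero_right] at ht
    exact ((differentiable_pow _) t).smul (hId t ht.le)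
  -- the coefficient extraction
  have hsphere : ∀ t ∈ sphere (0 : ℂ) ρ', t ≠ 0 ∧ ‖t‖ = ρ' := fun t ht => by
    rw [mem_sphere, dist_zero_right] at ht
    exact ⟨fun h0 => hρ'.ne' (by rw [← ht, h0, norm_zero]), ht⟩
  have hcongr : EqOn (fun t : ℂ => t ^ (-(k + 1 : ℤ)) • f t)
      (fun t => t ^ (-(k + 1 : ℤ)) • Ring.inverse (g t) + t ^ (K - k) • (rr t * Ring.inverse (g t)))
      (sphere (0 : ℂ) ρ') := by
    intro t ht
    obtain ⟨ht0, htn⟩ := hsphere t ht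
    have hu := (hunit t htn.le).1
    have hft : f t = (1 + t ^ (K + 1) • rr t) * Ring.inverse (g t) := by
      rw [← hfg, mul_assoc, Ring.mul_inverse_cancel _ hu, mul_one]
    have hz : t ^ (-(k + 1 : ℤ)) * t ^ (K + 1) = t ^ (K - k) := by
      have hcast : ((K - k : ℕ) : ℤ) = -(k + 1 : ℤ) + (K + 1 : ℕ) := by
        rw [Nat.cast_sub hk]; push_cast; ring
      rw [← zpow_natCast t (K + 1), ← zpow_add₀ ht0, ← zpow_natCast t (K - k), hcast]
    simp only
    rw [hft, add_mul, one_mul, smul_add, smul_mul_assoc, smul_smul, hz]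
  have hmain : (2 * π * I : ℂ) • ncEval X (hpart k Q) =
      ∮ t in C(0, ρ'), t ^ (-(k + 1 : ℤ)) • Ring.inverse (g t) := by
    have hex := circleIntegral_zpow_smul_sum_pow_smul (range (K + 1))
      (fun i => ncEval X (hpart i Q)) (fun i => i) k hρ'
    rw [Finset.filter_eq' (range (K + 1)) k, if_pos (mem_range.mpr (Nat.lt_succ_of_le hk)),
      Finset.sum_singleton] at hex
    rw [← hex]
    change (∮ t in C(0, ρ'), t ^ (-(k + 1 : ℤ)) • f t) = _
    rw [circleIntegral.integral_congr hρ'.le hcongr]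
    have hi1 : CircleIntegrable (fun t => t ^ (-(k + 1 : ℤ)) • Ring.inverse (g t)) 0 ρ' := by
      refine ContinuousOn.circleIntegrable hρ'.le ?_
      refine ContinuousOn.smul ?_ ?_
      · refine ContinuousOn.zpow₀ continuousOn_id _ fun t ht => Or.inl (hsphere t ht).1
      · intro t ht
        have htn := (hsphere t ht).2
        refine ContinuousAt.continuousWithinAt ?_
        exact ((differentiableAt_inverse (hunit t htn.le).1).comp t (hgd t)).continuousAt
    have hi2 : CircleIntegrable (fun t => t ^ (K - k) • (rr t * Ring.inverse (g t))) 0 ρ' := by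
      refine ContinuousOn.circleIntegrable hρ'.le ?_
      exact ((continuousOn_id.pow _).smul hIc).mono sphere_subset_closedBall
    rw [circleIntegral.integral_add hi1 hi2, hzero, add_zero]
  -- norms
  have hbound : ‖∮ t in C(0, ρ'), t ^ (-(k + 1 : ℤ)) • Ring.inverse (g t)‖ ≤
      2 * π * ρ' * (ρ'⁻¹ ^ (k + 1) * M₂) := by
    refine circleIntegral.norm_integral_le_of_norm_le_const hρ'.le fun t ht => ?_
    obtain ⟨ht0, htn⟩ := hsphere t ht
    rw [norm_smul, norm_zpow, htn, zpow_neg, ← inv_zpow,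
      show ((k : ℤ) + 1) = ((k + 1 : ℕ) : ℤ) by push_cast; ring, zpow_natCast]
    exact mul_le_mul_of_nonneg_left (hunit t htn.le).2 (pow_nonneg (inv_nonneg.mpr hρ'.le) _)
  have h2pi : ‖(2 * π * I : ℂ)‖ = 2 * π := by
    rw [norm_mul, norm_mul, Complex.norm_I, mul_one, Complex.norm_two, Complex.norm_real,
      Real.norm_of_nonneg Real.pi_pos.le]
  have hM₂ : 0 ≤ M₂ := le_trans (norm_nonneg _) (hunit 0 (by rw [norm_zero]; exact hρ'.le)).2
  have key : 2 * π * ‖ncEval X (hpart k Q)‖ ≤ 2 * π * (M₂ * ρ'⁻¹ ^ k) := by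
    calc 2 * π * ‖ncEval X (hpart k Q)‖ = ‖(2 * π * I : ℂ) • ncEval X (hpart k Q)‖ := by
          rw [norm_smul, h2pi]
      _ ≤ 2 * π * ρ' * (ρ'⁻¹ ^ (k + 1) * M₂) := by rw [hmain]; exact hbound
      _ = 2 * π * (M₂ * ρ'⁻¹ ^ k) := by
          rw [pow_succ]; field_simp
  exact le_of_mul_le_mul_left key Real.two_pi_pos

/-- A finite geometric sum bound. [folklore] -/
theorem geom_sum_le_inv_one_sub {r : ℝ} (h0 : 0 ≤ r) (h1 : r < 1) (n : ℕ) :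
    ∑ k ∈ range n, r ^ k ≤ (1 - r)⁻¹ := by
  have h := geom_sum_mul_neg r n
  have h1' : 0 < 1 - r := by linarith
  have hle : (∑ k ∈ range n, r ^ k) * (1 - r) ≤ 1 := by
    rw [h]; linarith [pow_nonneg h0 n]
  rwa [← le_div_iff₀ h1', one_div] at hle

/-- **`‖Q_K(X)‖ ≤ M₂ (1 - 1/ρ')⁻¹`** for contractions `X`. [folklore] -/
theorem norm_ncEval_qapprox_le {Pn : NC σ} (hP1 : Pn.coeff 1 = 1)
    {D : ℕ} (hD : ∀ u ∈ Pn.coeff.support, u.length ≤ D) {ρ' M₂ : ℝ} (hρ' : 1 < ρ')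
    (hinv : ∀ Y : σ → 𝔄, (∀ j, ‖Y j‖ ≤ ρ') →
      IsUnit (ncEval Y Pn) ∧ ‖Ring.inverse (ncEval Y Pn)‖ ≤ M₂)
    (X : σ → 𝔄) (hX : ∀ j, ‖X j‖ ≤ 1) (K : ℕ) :
    ‖ncEval X (qapprox K Pn)‖ ≤ M₂ * (1 - ρ'⁻¹)⁻¹ := by
  have hρ0 : 0 < ρ' := lt_trans zero_lt_one hρ'
  have hM₂ : 0 ≤ M₂ :=
    le_trans (norm_nonneg _) (hinv 0 fun j => by rw [Pi.zero_apply, norm_zero]; exact hρ0.le).2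
  have hr0 : 0 ≤ ρ'⁻¹ := inv_nonneg.mpr hρ0.le
  have hr1 : ρ'⁻¹ < 1 := inv_lt_one_of_one_lt₀ hρ'
  conv_lhs => rw [← sum_hpart_eq (qapprox K Pn) fun u hu => length_le_of_mem_support_qapprox hu,
    map_sum]
  refine le_trans (norm_sum_le _ _) ?_
  refine le_trans (Finset.sum_le_sum fun k hk =>
    norm_ncEval_hpart_qapprox_le hP1 hD hρ0 hinv X hX (Nat.le_of_lt_succ (mem_range.mp hk))) ?_
  rw [← Finset.mul_sum]
  exact mul_le_mul_of_nonneg_left (geom_sum_le_inv_one_sub hr0 hr1 _) hM₂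

/-- **`‖R_K(X)‖ ≤ D (D+1) M₂ |P̂|₁ ρ'^{-(K+1-D)}`** for contractions `X`. [folklore] -/
theorem norm_ncEval_rrem_le (h1 : ‖(1 : 𝔄)‖ ≤ 1) {Pn : NC σ} (hP1 : Pn.coeff 1 = 1)
    {D : ℕ} (hD : ∀ u ∈ Pn.coeff.support, u.length ≤ D) {ρ' M₂ : ℝ} (hρ' : 1 < ρ')
    (hinv : ∀ Y : σ → 𝔄, (∀ j, ‖Y j‖ ≤ ρ') →
      IsUnit (ncEval Y Pn) ∧ ‖Ring.inverse (ncEval Y Pn)‖ ≤ M₂)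
    (X : σ → 𝔄) (hX : ∀ j, ‖X j‖ ≤ 1) (K : ℕ) :
    ‖ncEval X (rrem K Pn)‖ ≤ D * (D + 1) * (M₂ * wnorm 1 Pn) * ρ'⁻¹ ^ (K + 1 - D) := by
  have hρ0 : 0 < ρ' := lt_trans zero_lt_one hρ'
  have hM₂ : 0 ≤ M₂ :=
    le_trans (norm_nonneg _) (hinv 0 fun j => by rw [Pi.zero_apply, norm_zero]; exact hρ0.le).2
  have hr0 : 0 ≤ ρ'⁻¹ := inv_nonneg.mpr hρ0.le
  have hr1 : ρ'⁻¹ ≤ 1 := inv_le_one_of_one_le₀ hρ'.le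
  have hW : 0 ≤ wnorm 1 Pn := wnorm_nonneg zero_le_one _
  set c := M₂ * wnorm 1 Pn * ρ'⁻¹ ^ (K + 1 - D) with hc
  have hc0 : 0 ≤ c := by positivity
  -- expand `R_K` into homogeneous parts of degree `K+1, …, K+D`
  have hRsum : rrem K Pn = ∑ m ∈ Finset.Ico (K + 1) (K + D + 1), hpart m (rrem K Pn) := by
    conv_lhs => rw [← sum_hpart_eq (rrem K Pn) fun u hu => length_le_of_mem_support_rrem hD K hu]
    rw [Finset.range_eq_Ico, ← Finset.sum_Ico_consecutive _ (Nat.zero_le (K + 1)) (by omega),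
      Finset.sum_eq_zero (s := Finset.Ico 0 (K + 1)), zero_add]
    intro m hm
    rw [Finset.mem_Ico] at hm
    exact hpart_rrem_eq_zero (by omega) hP1
  -- each homogeneous part is small
  have hpartle : ∀ m ∈ Finset.Ico (K + 1) (K + D + 1),
      ‖ncEval X (hpart m (rrem K Pn))‖ ≤ (D + 1) * c := by
    intro m hm
    rw [Finset.mem_Ico] at hm
    rw [hpart_rrem (by omega) K Pn, map_sum]
    refine le_trans (norm_sum_le _ _) ?_
    have hterm : ∀ p ∈ Finset.antidiagonal m,
        ‖ncEval X (hpart p.1 (qapprox K Pn) * hpart p.2 Pn)‖ ≤ if p.2 ≤ D then c else 0 := by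
      intro p hp
      rw [Finset.mem_antidiagonal] at hp
      split_ifs with h2
      · by_cases h1' : p.1 ≤ K
        · rw [map_mul]
          refine le_trans (norm_mul_le _ _) ?_
          have hq := norm_ncEval_hpart_qapprox_le hP1 hD hρ0 hinv X hX h1'
          have hPi : ‖ncEval X (hpart p.2 Pn)‖ ≤ wnorm 1 Pn :=
            le_trans (norm_ncEval_le X zero_le_one hX h1 _) (wnorm_wfilter_le zero_le_one _ Pn)
          have hpow : ρ'⁻¹ ^ p.1 ≤ ρ'⁻¹ ^ (K + 1 - D) :=
            pow_le_pow_of_le_one hr0 hr1 (by omega)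
          calc ‖ncEval X (hpart p.1 (qapprox K Pn))‖ * ‖ncEval X (hpart p.2 Pn)‖
              ≤ (M₂ * ρ'⁻¹ ^ p.1) * wnorm 1 Pn := mul_le_mul hq hPi (norm_nonneg _) (by positivity)
            _ ≤ (M₂ * ρ'⁻¹ ^ (K + 1 - D)) * wnorm 1 Pn :=
                mul_le_mul_of_nonneg_right (mul_le_mul_of_nonneg_left hpow hM₂) hW
            _ = c := by rw [hc]; ring
        · rw [hpart_qapprox_eq_zero (Nat.lt_of_not_le h1') Pn, zero_mul, map_zero, norm_zero]
          exact hc0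
      · rw [hpart_eq_zero_of_lt hD (Nat.lt_of_not_le h2), mul_zero, map_zero, norm_zero]
    refine le_trans (Finset.sum_le_sum hterm) ?_
    rw [← Finset.sum_filter, Finset.sum_const, nsmul_eq_mul]
    refine mul_le_mul_of_nonneg_right ?_ hc0
    have hcard : ((Finset.antidiagonal m).filter fun p => p.2 ≤ D).card ≤ (range (D + 1)).card := by
      refine Finset.card_le_card_of_injOn Prod.snd (fun p hp => ?_) ?_
      · rw [Finset.coe_filter] at hp
        exact mem_range.mpr (Nat.lt_succ_of_le hp.2)
      · intro p hp q hq hpq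
        rw [Finset.coe_filter, Set.mem_setOf_eq, Finset.mem_antidiagonal] at hp hq
        have h2 : p.2 = q.2 := hpq
        ext <;> omega
    rw [Finset.card_range] at hcard
    exact_mod_cast hcard
  rw [hRsum, map_sum]
  refine le_trans (norm_sum_le _ _) (le_trans (Finset.sum_le_sum hpartle) ?_)
  rw [Finset.sum_const, Nat.card_Ico, nsmul_eq_mul, show K + D + 1 - (K + 1) = D by omega, hc]
  ring_nf
  rfl

end Circle

/-! ### From invertibility on a larger nc polydisc to the `Q, E` certificates -/

section Package

/-- **Quantitative left invertibility.** If `P̂` (constant term `1`) is invertible with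
`‖P̂(Y)⁻¹‖ ≤ M₂` at every tuple `Y` of operators with `‖Y_j‖ ≤ ρ'` (`ρ' > 1`) on every Hilbert
space, then there is `C` such that for every `ε > 0` there are nc polynomials `Q, E` with
`Q P̂ + E = 1`, `‖Q(X)‖ ≤ C` and `‖E(X)‖ ≤ ε` at every tuple of Hilbert-space contractions.
[folklore] -/
theorem exists_QE_of_inv {Pn : NC σ} (hP1 : Pn.coeff 1 = 1) {D : ℕ}
    (hD : ∀ u ∈ Pn.coeff.support, u.length ≤ D) {ρ' M₂ : ℝ} (hρ' : 1 < ρ')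
    (hinv : ∀ (H : Type) [NormedAddCommGroup H] [InnerProductSpace ℂ H] [CompleteSpace H]
      (Y : σ → H →L[ℂ] H), (∀ j, ‖Y j‖ ≤ ρ') →
        IsUnit (ncEval Y Pn) ∧ ‖Ring.inverse (ncEval Y Pn)‖ ≤ M₂) :
    ∃ C : ℝ, 0 ≤ C ∧ ∀ ε : ℝ, 0 < ε → ∃ Q E : NC σ, Q * Pn + E = 1 ∧
      ∀ (H : Type) [NormedAddCommGroup H] [InnerProductSpace ℂ H] [CompleteSpace H]
        (X : σ → H →L[ℂ] H), (∀ j, ‖X j‖ ≤ 1) → ‖ncEval X Q‖ ≤ C ∧ ‖ncEval X E‖ ≤ ε := by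
  have hρ0 : 0 < ρ' := lt_trans zero_lt_one hρ'
  have hr0 : 0 ≤ ρ'⁻¹ := inv_nonneg.mpr hρ0.le
  have hr1 : ρ'⁻¹ < 1 := inv_lt_one_of_one_lt₀ hρ'
  refine ⟨max (M₂ * (1 - ρ'⁻¹)⁻¹) 0, le_max_right _ _, fun ε hε => ?_⟩
  -- choose `K`
  set A := |(D : ℝ) * (D + 1) * (M₂ * wnorm 1 Pn)| + 1 with hA
  have hA0 : 0 < A := by positivity
  obtain ⟨n, hn⟩ := exists_pow_lt_of_lt_one (div_pos hε hA0) hr1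
  refine ⟨qapprox (n + D) Pn, -rrem (n + D) Pn, by rw [rrem]; abel, fun H _ _ _ X hX => ?_⟩
  have h1 : ‖(1 : H →L[ℂ] H)‖ ≤ 1 := ContinuousLinearMap.norm_id_le
  refine ⟨le_trans (norm_ncEval_qapprox_le hP1 hD hρ' (hinv H) X hX _) (le_max_left _ _), ?_⟩
  rw [map_neg, norm_neg]
  refine le_trans (norm_ncEval_rrem_le h1 hP1 hD hρ' (hinv H) X hX _) ?_
  rw [show n + D + 1 - D = n + 1 by omega]
  have hpow : ρ'⁻¹ ^ (n + 1) ≤ ρ'⁻¹ ^ n := pow_le_pow_of_le_one hr0 hr1.le (Nat.le_succ n)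
  calc (D : ℝ) * (D + 1) * (M₂ * wnorm 1 Pn) * ρ'⁻¹ ^ (n + 1)
      ≤ A * ρ'⁻¹ ^ (n + 1) := by
        refine mul_le_mul_of_nonneg_right ?_ (pow_nonneg hr0 _)
        exact le_trans (le_abs_self _) (le_add_of_nonneg_right zero_le_one)
    _ ≤ A * ρ'⁻¹ ^ n := mul_le_mul_of_nonneg_left hpow hA0.le
    _ ≤ A * (ε / A) := mul_le_mul_of_nonneg_left hn.le hA0.le
    _ = ε := mul_div_cancel₀ ε hA0.ne'

end Package

end Invertibility

end GKVVW
end Literature.Analysis.OperatorTheory
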